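import Mathlib
import Literature.Algebra.Polynomial.HermiteRealRootedness
import Literature.Algebra.Polynomial.HermiteRankSignature
import Literature.Algebra.Polynomial.SosMatrix
import Literature.AlgebraicGeometry.DeterminantalHypersurfaces.MonicPencilRealZero
import Literature.AlgebraicGeometry.DeterminantalHypersurfaces.NetzerThom12RepresentationSize
import HarnessLib

/-!
# Netzer–Plaumann–Thom 2013, §1: the parametrised Hermite matrix of a real-zero polynomial

Source: T. Netzer, D. Plaumann, A. Thom, *Determinantal representations and the Hermite matrix*,
Michigan Math. J. 62 (2013) 407–420, doi:10.1307/mmj/1370870379 = arXiv:1108.4380 (held text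
`paper:arxiv-1108.4380`; numbering of the arXiv version) [cite: NetzerPlaumannThom2013, §1].

Setting (§1).  For a monic univariate `p = t^d + p_1 t^{d-1} + ⋯ + p_d` with complex zeros
`λ_1,…,λ_d` the **Newton sums** are `N_k(p) = Σ λ_i^k` — symmetric functions of the roots, hence
polynomials in the coefficients — and the **Hermite matrix** is the Hankel matrix
`H(p) = (N_{i+j-2}(p))_{i,j=1…d} = VᵀV` (`V` the Vandermonde matrix of the roots).  For
`p ∈ ℝ[x]` of degree `d` with `p(0) = 1`, written `p = Σ_{i=0}^d p_i` in homogeneous parts, the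
**parametrised Hermite matrix** `𝓗(p)` is the Hermite matrix of the homogenisation
`P(x,t) = Σ p_i t^{d−i} = t^d p(x/t)` regarded as a monic polynomial in `t`; its entries are
polynomials in `x`, the `(i,j)` entry homogeneous of degree `i+j−2`.  A *real-zero polynomial* is a
`p` with `p(0) = 1` such that every `t ↦ p(ta)` has only real zeros (the tree's
`MonicPencilRealZero.IsRZPoly`, normalisation `p(0) = 1` kept as a separate hypothesis), and a
*definite (symmetric linear) determinantal representation* is `p = det(I − 𝓜)`,
`𝓜 = x_1M_1 + ⋯ + x_nM_n` with real symmetric `M_i` — in the tree's normalisation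
`p = monicPencilDet A = det(I + Σ x_iA_i)`, i.e. `M_i = −A_i` (`linPencil A = 𝓜`).

## Dictionary (source item → Lean → status)

| Source | Lean | Status |
|---|---|---|
| §1, Newton sums «expressed as polynomials in the coefficients» | `newtonOfCoeff` (Newton's recursion), `newtonOfCoeff_eq_sum_pow` / `newtonOfCoeff_eq_sum_roots_pow` (= power sums of the roots, any commutative ring / split monic polynomial; Mathlib's `MvPolynomial.psum_eq_mul_esymm_sub_sum` evaluated at the roots), `newtonOfCoeff_eq_newtonSum` (= the tree's root-defined `Literature.Algebra.Polynomial.newtonSum` over `ℝ`) | def + proved |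
| §1, `H(p) = (N_{i+j−2})`, «`H(p) = VᵀV`» | `hermiteOfCoeff`, `hermiteOfCoeff_eq_transpose_vandermonde_mul` (Mathlib `Matrix.vandermonde`), `hermiteMatrix_eq_hermiteOfCoeff` (= the tree's `hermiteMatrix` for monic real `P`) | def + proved |
| Thm. 1.1 (Hermite; cited from Basu–Pollack–Roy Thm. 4.59) | rank clause AT FULL RANK: `det_hermiteOfCoeff_ne_zero_iff` (any domain), `det_hermiteMatrix_ne_zero_iff` (`det H(P) ≠ 0 ↔ P.Separable`); «in particular»: `posDef_hermiteMatrix_iff` (`H(P) ≻ 0 ↔` all zeros real and distinct) and the tree's `splits_iff_posSemidef_hermiteMatrix` (`⪰ 0 ↔` all zeros real), CITED | proved; the general rank (= number of distinct complex zeros) and signature (= number of distinct real zeros) clauses: `thm_1_1_rank`, `thm_1_1_signature` = the tree's `Literature.Algebra.Polynomial.HermiteSignature.rank_hermiteMatrix` / `card_eigenvalues_hermiteMatrix` (Hermite's theorem, `HermiteRankSignature.lean`), CITED here in the `d = deg P` form |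
| §1, homogenisation `P = Σ p_i t^{d−i}`, `𝓗(p) := H(P)` | `homogenization`, `homogenizationAt` (`= reflect d (linePoly p 0 a)`, `homogenizationAt_eq_reflect`), `paramHermite`, `map_eval_paramHermite` (`𝓗(p)(a) = hermiteMatrix (t^d p(a/t)) d`), `paramHermite_isSymm` | def + proved |
| Cor. 1.2 (`p` RZ iff `𝓗(p)(a) ⪰ 0 ∀a`) | `cor_1_2` | proved |
| Prop. 1.3 (= Netzer–Thom 2012 Prop. 2.1: non-zero eigenvalues of `𝓜(a)` ↔ zeros of `p(ta)`, `λ ↦ 1/λ`) | the tree's `NetzerThom2012.prop_2_1` / `roots_lineDet_eq` (for `W = Σ a_iA_i = −𝓜(a)`, `μ ↦ −1/μ`) | CITED, not restated |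
| Lemma 1.4 (`r·𝓗(p)(a)_{ij} = tr 𝓜(a)^{i+j−2}`, `(i,j) ≠ (1,1)`) | `lemma_1_4` (+ `paramHermite_zero_zero`, `homogenizationAt_pow_eq`: `P(a,t)^r = t^{dr−m} ∏_{μ≠0}(t+μ)`, `trace_pow_eq_sum_eigenvalues_pow`) | proved |
| Def. 1.5 (sum of squares `𝓗 = 𝒬ᵀ𝒬`, `𝒬` rectangular) | the tree's `Literature.Algebra.Polynomial.SosMatrix.IsSosMatrix` | CITED, not restated |
| Thm. 1.6 (`p^r = det(I − 𝓜)` of size `rd` ⇒ `𝓗(p)` SOS) | `thm_1_6` (+ `sosWitness` = the `𝒬` of the proof, `transpose_sosWitness_mul`) | proved |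
| Rem. 1.7 (1) (size `k > rd`: SOS after raising the `(1,1)` entry to `k/r`) | `rem_1_7_1` (every size `k`) | proved |
| Rem. 1.7 (2) (via Netzer–Thom Thm. 2.7/2.4: raise to `dn`, independent of `r`) | `rem_1_7_2` (uses the tree's `NetzerThom2012.thm_2_4`) | proved |
| Rem. 1.7 (3) (`det 𝓗(p)` = discriminant is SOS; Borchardt 1846) | `det_hermiteOfCoeff_eq`, `det_hermiteMatrix_eq_prod` (`= ∏_{i<j}(λ_j−λ_i)²`), `rem_1_7_3` (the tree's `IsSosMatrix.isSumSq_det`, Cauchy–Binet) | proved |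
| Rem. 1.7 (4) (recurrence characterisation) | — | prose, nothing to type |
| Example 1.8 (quadratic `p = xᵀAx + bᵀx + 1`) | `quadPoly`, `paramHermite_quadPoly` (`𝓗(p) = [[2, −bᵀx],[−bᵀx, xᵀ(bbᵀ−2A)x]]`), `isRZPoly_quadPoly_iff` («RZ iff `bbᵀ − 4A ⪰ 0`»), `example_1_8` (`𝓗(p) = 2·𝒬ᵀ𝒬` with `exampleQ`) | def + proved |
| Example 1.9 (Vámos polynomial, YALMIP numerics) | — | numerical, not typed |

§2–§3 (the construction `𝓛_t`, Thm. 2.5, Thm. 3.1) are typed in the sibling file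
`NetzerPlaumannThom13Construction.lean`.

## Typed-vs-printed

* The printed standing hypothesis «`p` real-zero of degree `d`» of Lemma 1.4 / Thm. 1.6 is
  weakened to `p(0) = 1 ∧ deg p ≤ d` (`MvPolynomial.constantCoeff p = 1`, `p.totalDegree ≤ d`):
  the real-zero property follows from the representation and is used nowhere in the proofs; with
  `deg p < d` the statements stay true as typed (the homogenisation acquires a factor `t^{d−deg p}`).
  `r > 0` is needed in Thm. 1.6 only (Lemma 1.4 as typed holds for `r = 0` too).
* Thm. 1.6's `𝒬` is indexed by the pairs `(ℓ,m)` (a `Fintype`), reindexed to `Fin s` inside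
  `IsSosMatrix` by the tree's `isSosMatrix_transpose_mul_self`; the constant `r^{−1/2}` is absorbed.
* `𝓗(p)` is DEFINED through Newton's recursion (honest polynomial entries over any commutative
  ring); its agreement with the root definition is `map_eval_paramHermite`.  Sign/normalisation:
  `𝓜 = linPencil A = −Σ x_iA_i`, `det(I − 𝓜) = monicPencilDet A` (`det_one_sub_linPencil`).
* Lemma 1.4's proof: instead of Prop. 1.3 on each eigenvalue we factor
  `P(a,t)^r = t^{dr−m}∏_{μ_l ≠ 0}(t + μ_l)` (`μ_l` the eigenvalues of `Σ a_iA_i`, spectral theorem via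
  the tree's `lineDet_eq_prod`) and read off the power sums; same content.

Honest framing: dictionary literature for the V1 line (symmetric/definite determinantal
representations and certificates of the real-zero property); no route item is touched; nothing here
bears on lower bounds for the permanent.
-/

noncomputable section

open Polynomial Matrix Finset
open Literature.AlgebraicGeometry.DeterminantalHypersurfaces.MonicPencilRealZero

namespace Literature.AlgebraicGeometry.DeterminantalHypersurfaces.NetzerPlaumannThom2013

/-! ## Newton sums as polynomials in the coefficients -/

section Newton

variable {R : Type*} [CommRing R]

/-- **Newton sums from the coefficients.** For a natural number `d` and a coefficient sequence
`c : ℕ → R`, read as the monic polynomial `P = t^d + c 1 · t^{d-1} + ⋯ + c d` (the value `c 0`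
is never used, and `c k` for `k > d` should be `0`), `newtonOfCoeff d c k` is the `k`-th Newton
sum `N_k(P)` computed by Newton's recursion
`N_0 = d`, `N_k = -(k·c_k + Σ_{i=1}^{k-1} c_i N_{k-i})`; over a field in which `P` splits it is the
`k`-th power sum of the roots (`newtonOfCoeff_eq_sum_pow`).  This is the sentence «the Newton sums
are symmetric functions in the roots, and can thus be expressed as polynomials in the coefficients
`p_i` of `p`» of the source. [cite: NetzerPlaumannThom2013, §1 (before Thm. 1.1)] -/
def newtonOfCoeff (d : ℕ) (c : ℕ → R) : ℕ → R
  | 0 => d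
  | k + 1 => -(((k + 1 : ℕ) : R) * c (k + 1) + ∑ i : Fin k, c ((i : ℕ) + 1) * newtonOfCoeff d c (k - i))
termination_by k => k
decreasing_by omega

/-- Unfolding at `0`: `N_0 = d`. [cite: NetzerPlaumannThom2013, §1] -/
@[simp] theorem newtonOfCoeff_zero (d : ℕ) (c : ℕ → R) : newtonOfCoeff d c 0 = d := by
  rw [newtonOfCoeff]

/-- Unfolding at `k + 1` (Newton's recursion). [cite: NetzerPlaumannThom2013, §1] -/
theorem newtonOfCoeff_succ (d : ℕ) (c : ℕ → R) (k : ℕ) :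
    newtonOfCoeff d c (k + 1) =
      -(((k + 1 : ℕ) : R) * c (k + 1) + ∑ i : Fin k, c ((i : ℕ) + 1) * newtonOfCoeff d c (k - i)) := by
  rw [newtonOfCoeff]

/-- Newton sums only depend on `c 1, c 2, …`. [cite: NetzerPlaumannThom2013, §1 (Newton sums)] -/
theorem newtonOfCoeff_congr {d : ℕ} {c c' : ℕ → R} (h : ∀ k, 0 < k → c k = c' k) :
    ∀ k, newtonOfCoeff d c k = newtonOfCoeff d c' k := by
  intro k
  induction k using Nat.strong_induction_on with
  | _ k ih =>
    cases k with
    | zero => simp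
    | succ k =>
      rw [newtonOfCoeff_succ, newtonOfCoeff_succ, h (k + 1) (Nat.succ_pos k)]
      congr 2
      refine Finset.sum_congr rfl fun i _ => ?_
      rw [h _ (Nat.succ_pos _), ih (k - i) (by omega)]

/-- Newton sums commute with ring homomorphisms (they are integer polynomials in the
coefficients). [cite: NetzerPlaumannThom2013, §1] -/
theorem map_newtonOfCoeff {S : Type*} [CommRing S] (f : R →+* S) (d : ℕ) (c : ℕ → R) :
    ∀ k, f (newtonOfCoeff d c k) = newtonOfCoeff d (fun i => f (c i)) k := by
  intro k
  induction k using Nat.strong_induction_on with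
  | _ k ih =>
    cases k with
    | zero => simp
    | succ k =>
      rw [newtonOfCoeff_succ, newtonOfCoeff_succ, map_neg, map_add, map_mul, map_natCast,
        map_sum]
      congr 2
      refine Finset.sum_congr rfl fun i _ => ?_
      rw [map_mul, ih (k - i) (by omega)]

/-- Reindexing the inner sum of Newton's recursion along the antidiagonal. [folklore] -/
private theorem sum_fin_eq_sum_antidiagonal (k : ℕ) (g : ℕ → ℕ → R) :
    ∑ i : Fin k, g ((i : ℕ) + 1) (k - i) =
      ∑ a ∈ (antidiagonal (k + 1)).filter (fun a => a.1 ∈ Set.Ioo 0 (k + 1)), g a.1 a.2 := by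
  rw [Finset.sum_filter, Finset.Nat.sum_antidiagonal_eq_sum_range_succ
    (fun i j => if (i, j).1 ∈ Set.Ioo 0 (k + 1) then g i j else 0) (k + 1),
    Finset.sum_range_succ', Finset.sum_range_succ,
    Fin.sum_univ_eq_sum_range (fun i => g (i + 1) (k - i)) k]
  simp only [Set.mem_Ioo, lt_self_iff_false, and_false, false_and, if_false, add_zero]
  refine Finset.sum_congr rfl fun i hi => ?_
  rw [Finset.mem_range] at hi
  rw [if_pos ⟨Nat.succ_pos i, by omega⟩]
  congr 1
  omega

/-- **Newton's identities, solved for the power sums.** If `c k = (-1)^k e_k(s)` for all `k ≥ 1`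
(the coefficients of `∏_{x ∈ s} (t - x) = t^d + c 1 t^{d-1} + ⋯ + c d`, `d = |s|`, by Vieta), then
Newton's recursion returns the power sums: `newtonOfCoeff |s| c k = Σ_{x ∈ s} x^k`.
(Mathlib's `MvPolynomial.psum_eq_mul_esymm_sub_sum`, evaluated at the elements of `s`.)
[cite: NetzerPlaumannThom2013, §1 (Newton sums «can thus be expressed as polynomials in the coefficients»)] -/
theorem newtonOfCoeff_eq_sum_pow (s : Multiset R) (c : ℕ → R)
    (hc : ∀ k, 0 < k → c k = (-1) ^ k * s.esymm k) (k : ℕ) :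
    newtonOfCoeff (Multiset.card s) c k = (s.map (· ^ k)).sum := by
  -- enumerate `s` by a list
  obtain ⟨l, hl⟩ : ∃ l : List R, (l : Multiset R) = s := ⟨s.toList, s.coe_toList⟩
  subst hl
  set x : Fin l.length → R := l.get with hx
  have hval : (univ.val.map x : Multiset R) = (l : Multiset R) := by
    rw [Fin.univ_val_map, hx, List.ofFn_get]
  have hpsum : ∀ n, MvPolynomial.aeval x (MvPolynomial.psum (Fin l.length) R n) =
      ((l : Multiset R).map (· ^ n)).sum := by
    intro n
    simp only [MvPolynomial.psum, map_sum, map_pow, MvPolynomial.aeval_X]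
    rw [Finset.sum_eq_multiset_sum, ← hval, Multiset.map_map]
    rfl
  have hesymm : ∀ n, MvPolynomial.aeval x (MvPolynomial.esymm (Fin l.length) R n) =
      (l : Multiset R).esymm n := by
    intro n
    rw [MvPolynomial.aeval_esymm_eq_multiset_esymm, hval]
  induction k using Nat.strong_induction_on with
  | _ k ih =>
    cases k with
    | zero => simp
    | succ k =>
      have hN := congrArg (MvPolynomial.aeval x)
        (MvPolynomial.psum_eq_mul_esymm_sub_sum (Fin l.length) R (k + 1) (Nat.succ_pos k))
      rw [hpsum, map_sub, map_mul, map_mul, map_pow, map_neg, map_one, map_natCast, hesymm,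
        map_sum] at hN
      rw [hN, newtonOfCoeff_succ, hc (k + 1) (Nat.succ_pos k)]
      have hinner : ∑ i : Fin k, c ((i : ℕ) + 1) * newtonOfCoeff (Multiset.card (l : Multiset R)) c (k - i)
          = ∑ a ∈ (antidiagonal (k + 1)).filter (fun a => a.1 ∈ Set.Ioo 0 (k + 1)),
              (-1) ^ a.1 * (l : Multiset R).esymm a.1 * ((l : Multiset R).map (· ^ a.2)).sum := by
        rw [← sum_fin_eq_sum_antidiagonal k
          (fun i j => (-1) ^ i * (l : Multiset R).esymm i * ((l : Multiset R).map (· ^ j)).sum)]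
        refine Finset.sum_congr rfl fun i _ => ?_
        rw [hc ((i : ℕ) + 1) (Nat.succ_pos i), ih (k - i) (by omega)]
      rw [hinner]
      have hterm : ∀ a ∈ (antidiagonal (k + 1)).filter (fun a => a.1 ∈ Set.Ioo 0 (k + 1)),
          MvPolynomial.aeval x ((-1) ^ a.1 * MvPolynomial.esymm (Fin l.length) R a.1 *
            MvPolynomial.psum (Fin l.length) R a.2) =
          (-1) ^ a.1 * (l : Multiset R).esymm a.1 * ((l : Multiset R).map (· ^ a.2)).sum := by
        intro a _
        rw [map_mul, map_mul, map_pow, map_neg, map_one, hesymm, hpsum]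
      rw [Finset.sum_congr rfl hterm]
      ring

/-- The coefficient sequence of the monic polynomial `∏_{x ∈ s} (t - x)` in the format of
`newtonOfCoeff`: `c k = coeff of t^{d-k}` for `1 ≤ k ≤ d`, `c k = 0` for `k > d`, satisfies the
Vieta hypothesis of `newtonOfCoeff_eq_sum_pow`. [cite: NetzerPlaumannThom2013, §1 (Newton sums)] -/
theorem coeff_prod_X_sub_C_eq_esymm (s : Multiset R) (k : ℕ) :
    (if k ≤ Multiset.card s then ((s.map fun x => X - C x).prod).coeff (Multiset.card s - k) else 0)
      = (-1) ^ k * s.esymm k := by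
  split_ifs with h
  · rw [Multiset.prod_X_sub_C_coeff s (Nat.sub_le _ _), Nat.sub_sub_self h]
  · push Not at h
    have h0 : s.esymm k = 0 := by
      rw [Multiset.esymm, Multiset.powersetCard_eq_empty k h]
      simp
    rw [h0, mul_zero]

/-- **Newton sums of a split monic polynomial are the power sums of its roots.**  For a monic
`P` over a field `F` that splits, with `d = deg P`, Newton's recursion on the
coefficients `c k = P.coeff (d - k)` (`k ≤ d`; `0` beyond) gives `N_k(P) = Σ_{λ} λ^k`, the sum over
the roots with multiplicity. [cite: NetzerPlaumannThom2013, §1 (definition of `N_k(p)`)] -/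
theorem newtonOfCoeff_eq_sum_roots_pow {F : Type*} [Field F] {P : F[X]} (hmonic : P.Monic)
    (hsplit : P.Splits) (c : ℕ → F)
    (hc : ∀ k, 0 < k → c k = if k ≤ P.natDegree then P.coeff (P.natDegree - k) else 0) (k : ℕ) :
    newtonOfCoeff P.natDegree c k = (P.roots.map (· ^ k)).sum := by
  have hP : P = (P.roots.map fun x => X - C x).prod := by
    have h := hsplit.eq_prod_roots
    rwa [hmonic.leadingCoeff, map_one, one_mul] at h
  have hcard : Multiset.card P.roots = P.natDegree := (hsplit.natDegree_eq_card_roots).symm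
  rw [← hcard]
  refine newtonOfCoeff_eq_sum_pow P.roots c (fun j hj => ?_) k
  rw [hc j hj, ← coeff_prod_X_sub_C_eq_esymm P.roots j, hcard, ← hP]

/-- `newtonOfCoeff_eq_sum_pow` with the size as a separate parameter. [cite: NetzerPlaumannThom2013, §1 (Newton sums)] -/
theorem newtonOfCoeff_eq_sum_pow' {d : ℕ} (s : Multiset R) (hd : Multiset.card s = d) (c : ℕ → R)
    (hc : ∀ k, 0 < k → c k = (-1) ^ k * s.esymm k) (k : ℕ) :
    newtonOfCoeff d c k = (s.map (· ^ k)).sum := by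
  subst hd
  exact newtonOfCoeff_eq_sum_pow s c hc k

/-- The **Hermite (Hankel) matrix from the coefficients**: `(N_{i+j})_{0 ≤ i,j < d}` with the
Newton sums computed by Newton's recursion from `c` (see `newtonOfCoeff`); for a monic split
polynomial this is `H(p) = (N_{i+j−2}(p))_{i,j=1…d}` of the source. [cite: NetzerPlaumannThom2013, §1 (definition of `H(p)`)] -/
def hermiteOfCoeff (d : ℕ) (c : ℕ → R) : Matrix (Fin d) (Fin d) R :=
  Matrix.of fun i j => newtonOfCoeff d c ((i : ℕ) + j)

/-- Entries of `hermiteOfCoeff`. [cite: NetzerPlaumannThom2013, §1] -/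
theorem hermiteOfCoeff_apply (d : ℕ) (c : ℕ → R) (i j : Fin d) :
    hermiteOfCoeff d c i j = newtonOfCoeff d c ((i : ℕ) + j) := rfl

/-- `hermiteOfCoeff` commutes with ring homomorphisms. [cite: NetzerPlaumannThom2013, §1 (definition of `H(p)`)] -/
theorem map_hermiteOfCoeff {S : Type*} [CommRing S] (f : R →+* S) (d : ℕ) (c : ℕ → R) :
    (hermiteOfCoeff d c).map f = hermiteOfCoeff d (fun k => f (c k)) := by
  ext i j
  rw [Matrix.map_apply, hermiteOfCoeff_apply, hermiteOfCoeff_apply, map_newtonOfCoeff]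

/-- **`H(p) = Vᵀ V` with `V` the Vandermonde matrix of the roots** («Note that `H(p) = VᵀV`, where
`V` is the Vandermonde matrix with coefficients `λ_1, …, λ_d`»): if `v : Fin d → R` enumerates the
roots with multiplicity (so that `c k = (−1)^k e_k(v)` are the coefficients of `∏ (t − v_i)`),
then `(N_{i+j}) = Vᵀ V` for Mathlib's `Matrix.vandermonde v` (rows `(1, v_i, v_i², …)`).
[cite: NetzerPlaumannThom2013, §1 (before Thm. 1.1)] -/
theorem hermiteOfCoeff_eq_transpose_vandermonde_mul {d : ℕ} (v : Fin d → R) (c : ℕ → R)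
    (hc : ∀ k, 0 < k → c k = (-1) ^ k * ((univ : Finset (Fin d)).val.map v).esymm k) :
    hermiteOfCoeff d c = (Matrix.vandermonde v)ᵀ * Matrix.vandermonde v := by
  ext i j
  rw [hermiteOfCoeff_apply, newtonOfCoeff_eq_sum_pow' ((univ : Finset (Fin d)).val.map v)
    (by simp) c hc, Matrix.mul_apply, Multiset.map_map, ← Finset.sum_eq_multiset_sum]
  refine Finset.sum_congr rfl fun l _ => ?_
  simp [Matrix.vandermonde_apply, pow_add]

/-- Hence `det H(p) = ∏_{i<j} (λ_j − λ_i)²` is the discriminant of `p` («the determinant of `𝓗(p)`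
is the discriminant of `t^d p(t⁻¹x)` in `t`»). [cite: NetzerPlaumannThom2013, Rem. 1.7 (3)] -/
theorem det_hermiteOfCoeff_eq {d : ℕ} (v : Fin d → R) (c : ℕ → R)
    (hc : ∀ k, 0 < k → c k = (-1) ^ k * ((univ : Finset (Fin d)).val.map v).esymm k) :
    (hermiteOfCoeff d c).det = (∏ i : Fin d, ∏ j ∈ Ioi i, (v j - v i)) ^ 2 := by
  rw [hermiteOfCoeff_eq_transpose_vandermonde_mul v c hc, det_mul, det_transpose,
    Matrix.det_vandermonde, sq]

/-- **Thm. 1.1, rank clause at full rank (any field).** `H(p)` is nonsingular iff the roots are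
pairwise distinct. [cite: NetzerPlaumannThom2013, Thm. 1.1] -/
theorem det_hermiteOfCoeff_ne_zero_iff [IsDomain R] {d : ℕ} (v : Fin d → R) (c : ℕ → R)
    (hc : ∀ k, 0 < k → c k = (-1) ^ k * ((univ : Finset (Fin d)).val.map v).esymm k) :
    (hermiteOfCoeff d c).det ≠ 0 ↔ Function.Injective v := by
  rw [hermiteOfCoeff_eq_transpose_vandermonde_mul v c hc, det_mul, det_transpose, mul_self_ne_zero,
    Matrix.det_vandermonde_ne_zero_iff]

/-- The Vieta hypothesis for an enumeration `v` of the roots of a monic split polynomial `P`: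
the coefficient sequence `c k = P.coeff (d − k)` (`k ≤ d = deg P`, `0` beyond) satisfies
`c k = (−1)^k e_k(v)`. [cite: NetzerPlaumannThom2013, §1 (Newton sums)] -/
theorem coeff_eq_esymm_of_roots_eq {F : Type*} [Field F] {P : F[X]} (hmonic : P.Monic) (hsplit : P.Splits)
    {d : ℕ} (hd : P.natDegree = d) (v : Fin d → F) (hv : (univ : Finset (Fin d)).val.map v = P.roots)
    (c : ℕ → F) (hc : ∀ k, 0 < k → c k = if k ≤ d then P.coeff (d - k) else 0) (k : ℕ) (hk : 0 < k) :
    c k = (-1) ^ k * ((univ : Finset (Fin d)).val.map v).esymm k := by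
  have hP : P = (P.roots.map fun x => X - C x).prod := by
    have h := hsplit.eq_prod_roots
    rwa [hmonic.leadingCoeff, map_one, one_mul] at h
  have hcard : Multiset.card P.roots = d := by rw [← hd]; exact (hsplit.natDegree_eq_card_roots).symm
  rw [hv, hc k hk, ← coeff_prod_X_sub_C_eq_esymm P.roots k, hcard, ← hP]

end Newton


/-! ## Newton sums of a real polynomial: agreement with the root definition of the tree -/

section RealNewton

open Literature.Algebra.Polynomial

/-- For a monic real polynomial, Newton's recursion on the coefficients computes the tree's
(root-defined) Newton sums `newtonSum P k = Re Σ_{x ∈ Zer(P,ℂ)} μ(x) x^k`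
(`Literature.Algebra.Polynomial.newtonSum`). [cite: NetzerPlaumannThom2013, §1 (definition of `N_k`)] -/
theorem newtonOfCoeff_eq_newtonSum {P : ℝ[X]} (hmonic : P.Monic) (c : ℕ → ℝ)
    (hc : ∀ k, 0 < k → c k = if k ≤ P.natDegree then P.coeff (P.natDegree - k) else 0) (k : ℕ) :
    newtonOfCoeff P.natDegree c k = newtonSum P k := by
  have hmap : (algebraMap ℝ ℂ) (newtonOfCoeff P.natDegree c k) = newtonSumC P k := by
    rw [map_newtonOfCoeff, newtonSumC_def, aroots_def]
    have hm : (P.map (algebraMap ℝ ℂ)).Monic := hmonic.map _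
    have hd : (P.map (algebraMap ℝ ℂ)).natDegree = P.natDegree := natDegree_map _
    rw [← hd]
    refine newtonOfCoeff_eq_sum_roots_pow hm (IsAlgClosed.splits _) _ (fun j hj => ?_) k
    rw [hc j hj, hd]
    split_ifs <;> simp [coeff_map]
  rw [newtonSum_def, ← hmap]
  exact (Complex.ofReal_re _).symm

/-- The tree's root-defined Hermite matrix of a monic real polynomial of degree `d` is the
coefficient-defined one. [cite: NetzerPlaumannThom2013, §1] -/
theorem hermiteMatrix_eq_hermiteOfCoeff {P : ℝ[X]} (hmonic : P.Monic) {d : ℕ} (hd : P.natDegree = d)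
    (c : ℕ → ℝ) (hc : ∀ k, 0 < k → c k = if k ≤ d then P.coeff (d - k) else 0) :
    hermiteMatrix P d = hermiteOfCoeff d c := by
  ext i j
  rw [hermiteMatrix_apply, hermiteOfCoeff_apply]
  subst hd
  exact (newtonOfCoeff_eq_newtonSum hmonic c hc _).symm

/-- An enumeration of the complex roots of a real polynomial of degree `d` by `Fin d` (the
`λ_1, …, λ_d` of Thm. 1.1). [cite: NetzerPlaumannThom2013, Thm. 1.1] -/
theorem exists_enum_aroots {P : ℝ[X]} {d : ℕ} (hd : P.natDegree = d) :
    ∃ v : Fin d → ℂ, (univ : Finset (Fin d)).val.map v = P.aroots ℂ := by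
  obtain ⟨l, hl⟩ : ∃ l : List ℂ, (l : Multiset ℂ) = P.aroots ℂ := ⟨_, Multiset.coe_toList _⟩
  have hlen : l.length = d := by
    rw [← Multiset.coe_card, hl, aroots_def, IsAlgClosed.card_roots_eq_natDegree, natDegree_map, hd]
  subst hlen
  exact ⟨l.get, by rw [Fin.univ_val_map, List.ofFn_get, hl]⟩

/-- **Thm. 1.1 (Hermite), determinant clause / Rem. 1.7 (3).** For a monic real `P` of degree `d`
with complex roots `λ_1, …, λ_d` (enumerated with multiplicity by `v`),
`det H(P) = ∏_{i<j} (λ_j − λ_i)²` — the discriminant. [cite: NetzerPlaumannThom2013, Thm. 1.1 and Rem. 1.7 (3)] -/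
theorem det_hermiteMatrix_eq_prod {P : ℝ[X]} (hmonic : P.Monic) {d : ℕ} (hd : P.natDegree = d)
    (v : Fin d → ℂ) (hv : (univ : Finset (Fin d)).val.map v = P.aroots ℂ) :
    ((hermiteMatrix P d).det : ℂ) = (∏ i : Fin d, ∏ j ∈ Ioi i, (v j - v i)) ^ 2 := by
  set c : ℕ → ℝ := fun k => if k ≤ d then P.coeff (d - k) else 0 with hc
  have hH := hermiteMatrix_eq_hermiteOfCoeff hmonic hd c (fun k _ => rfl)
  rw [hH, ← Complex.coe_algebraMap, RingHom.map_det, RingHom.mapMatrix_apply, map_hermiteOfCoeff]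
  have hm : (P.map (algebraMap ℝ ℂ)).Monic := hmonic.map _
  have hdm : (P.map (algebraMap ℝ ℂ)).natDegree = d := by rw [natDegree_map, hd]
  refine det_hermiteOfCoeff_eq v _ (coeff_eq_esymm_of_roots_eq hm (IsAlgClosed.splits _) hdm v
    (by rw [hv, aroots_def]) _ (fun k hk => ?_))
  simp only [hc]
  split_ifs <;> simp [coeff_map]

/-- **Thm. 1.1 (Hermite), rank clause at full rank.** For a monic real polynomial `P` of degree `d`:
`H(P)` is nonsingular iff the `d` complex zeros of `P` are pairwise distinct (`P` separable).
(The general clause «rank `H(p)` = number of distinct complex zeros» is `thm_1_1_rank` below.)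
[cite: NetzerPlaumannThom2013, Thm. 1.1] -/
theorem det_hermiteMatrix_ne_zero_iff {P : ℝ[X]} (hmonic : P.Monic) {d : ℕ} (hd : P.natDegree = d) :
    (hermiteMatrix P d).det ≠ 0 ↔ P.Separable := by
  obtain ⟨v, hv⟩ := exists_enum_aroots hd
  have hdet := det_hermiteMatrix_eq_prod hmonic hd v hv
  have hne : (hermiteMatrix P d).det ≠ 0 ↔ ((hermiteMatrix P d).det : ℂ) ≠ 0 := by
    rw [Ne, Ne, Complex.ofReal_eq_zero]
  rw [hne, hdet, ← Matrix.det_vandermonde, sq, mul_self_ne_zero, Matrix.det_vandermonde_ne_zero_iff]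
  -- `v` injective iff the complex roots are simple iff `P` is separable
  have hP0 : P.map (algebraMap ℝ ℂ) ≠ 0 := Polynomial.map_ne_zero hmonic.ne_zero
  rw [← Polynomial.separable_map (algebraMap ℝ ℂ), ← nodup_roots_iff_of_splits hP0
    (IsAlgClosed.splits _), ← aroots_def, ← hv, Fin.univ_val_map, Multiset.coe_nodup,
    List.nodup_ofFn]

/-- **Thm. 1.1 (Hermite), rank clause:** «the rank of `H(p)` equals the number of distinct zeros
of `p` in `ℂ`» — for a real `P` of degree `d`, `rank H(P) = #Zer(P, ℂ)`.  This is the tree's Hermite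
theorem `HermiteSignature.rank_hermiteMatrix` (BPR Thm. 4.57) at the printed size `d = deg P`.
[cite: NetzerPlaumannThom2013, Thm. 1.1] [cite: BasuPollackRoy2006, Thm. 4.57] -/
theorem thm_1_1_rank {P : ℝ[X]} {d : ℕ} (hd : P.natDegree = d) :
    (hermiteMatrix P d).rank = (P.aroots ℂ).toFinset.card :=
  Literature.Algebra.Polynomial.HermiteSignature.rank_hermiteMatrix P hd.le

/-- **Thm. 1.1 (Hermite), signature clause:** «the signature of `H(p)` equals the number of distinct
real zeros of `p`» — for a real `P` of degree `d`, `#{λ > 0} − #{λ < 0} = #Zer(P, ℝ)` for the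
eigenvalues `λ` of the real symmetric matrix `H(P)` (the tree's `HermiteSignature.signature_hermiteMatrix`,
from `card_eigenvalues_hermiteMatrix`: `#{λ > 0} = #real + #pairs`, `#{λ < 0} = #pairs`).
[cite: NetzerPlaumannThom2013, Thm. 1.1] [cite: BasuPollackRoy2006, Thm. 4.57] -/
theorem thm_1_1_signature {P : ℝ[X]} {d : ℕ} (hd : P.natDegree = d) :
    (Fintype.card {i // 0 < (hermiteMatrix_isHermitian P d).eigenvalues i} : ℤ) -
        Fintype.card {i // (hermiteMatrix_isHermitian P d).eigenvalues i < 0} =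
      P.roots.toFinset.card :=
  Literature.Algebra.Polynomial.HermiteSignature.signature_hermiteMatrix P hd.le

/-- **Thm. 1.1 (Hermite), the «in particular» sentence.** For a monic real `P` of degree `d`:
`H(P)` is positive definite iff all zeros of `P` are real and pairwise distinct; and (the tree's
`splits_iff_posSemidef_hermiteMatrix`) `H(P)` is positive semidefinite iff all zeros are real.
[cite: NetzerPlaumannThom2013, Thm. 1.1] -/
theorem posDef_hermiteMatrix_iff {P : ℝ[X]} (hmonic : P.Monic) {d : ℕ} (hd : P.natDegree = d) :
    (hermiteMatrix P d).PosDef ↔ P.Splits ∧ P.Separable := by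
  constructor
  · intro h
    refine ⟨(splits_iff_posSemidef_hermiteMatrix hd.le).mpr h.posSemidef, ?_⟩
    rw [← det_hermiteMatrix_ne_zero_iff hmonic hd]
    exact h.det_pos.ne'
  · rintro ⟨hs, hsep⟩
    have hpsd := (splits_iff_posSemidef_hermiteMatrix hd.le).mp hs
    have hdet := (det_hermiteMatrix_ne_zero_iff hmonic hd).mpr hsep
    refine PosDef.of_dotProduct_mulVec_pos hpsd.isHermitian fun x hx => ?_
    refine lt_of_le_of_ne (hpsd.dotProduct_mulVec_nonneg x) fun h0 => hx ?_
    have hker : hermiteMatrix P d *ᵥ x = 0 := (hpsd.dotProduct_mulVec_zero_iff x).mp h0.symm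
    exact Matrix.eq_zero_of_mulVec_eq_zero hdet hker
end RealNewton

/-! ## The homogenisation `P(x,t) = t^d p(x/t)` and the parametrised Hermite matrix `𝓗(p)` -/

section ParamHermite

variable {R : Type*} [CommRing R] {ι : Type*}

/-- The **homogenisation** of `p = p_0 + p_1 + ⋯ + p_d` (`p_i` homogeneous of degree `i`) with
respect to a new variable `t`, as a univariate polynomial over `R[x]`:
`P(x,t) = Σ_{i=0}^{d} p_i t^{d-i} = t^d p(x/t)` («`P = Σ p_i t^{d−i}`, a monic univariate
polynomial in `t`» when `p_0 = p(0) = 1`). [cite: NetzerPlaumannThom2013, §1 (before Cor. 1.2)] -/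
def homogenization (p : MvPolynomial ι R) (d : ℕ) : Polynomial (MvPolynomial ι R) :=
  ∑ i ∈ range (d + 1), Polynomial.C (MvPolynomial.homogeneousComponent i p) * Polynomial.X ^ (d - i)

/-- Coefficients of the homogenisation: the coefficient of `t^{d-k}` is `p_k` (`k ≤ d`).
[cite: NetzerPlaumannThom2013, §1] -/
theorem coeff_homogenization (p : MvPolynomial ι R) (d k : ℕ) (hk : k ≤ d) :
    (homogenization p d).coeff (d - k) = MvPolynomial.homogeneousComponent k p := by
  rw [homogenization, finsetSum_coeff]
  simp only [coeff_C_mul, coeff_X_pow]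
  rw [Finset.sum_eq_single k]
  · simp
  · intro i hi hik
    rw [Finset.mem_range] at hi
    rw [if_neg (by omega), mul_zero]
  · intro h
    exact absurd (Finset.mem_range.mpr (by omega)) h

/-- Coefficients of the homogenisation above `d` vanish. [cite: NetzerPlaumannThom2013, §1] -/
theorem coeff_homogenization_of_lt (p : MvPolynomial ι R) (d k : ℕ) (hk : d < k) :
    (homogenization p d).coeff k = 0 := by
  rw [homogenization, finsetSum_coeff]
  refine Finset.sum_eq_zero fun i _ => ?_
  simp only [coeff_C_mul, coeff_X_pow]
  rw [if_neg (by omega), mul_zero]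

/-- The homogenisation has degree `≤ d`. [cite: NetzerPlaumannThom2013, §1] -/
theorem natDegree_homogenization_le (p : MvPolynomial ι R) (d : ℕ) :
    (homogenization p d).natDegree ≤ d := by
  rw [Polynomial.natDegree_le_iff_coeff_eq_zero]
  intro k hk
  exact coeff_homogenization_of_lt p d k (by exact_mod_cast hk)

/-- The coefficient of `t^d` in `P` is `p_0 = p(0)`. [cite: NetzerPlaumannThom2013, §1] -/
theorem coeff_homogenization_self (p : MvPolynomial ι R) (d : ℕ) :
    (homogenization p d).coeff d = MvPolynomial.C (MvPolynomial.constantCoeff p) := by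
  have h := coeff_homogenization p d 0 (Nat.zero_le d)
  rw [Nat.sub_zero] at h
  rw [h, MvPolynomial.homogeneousComponent_zero]
  rfl

/-- If `p(0) = 1` then `P(x,t) = t^d + p_1 t^{d-1} + ⋯ + p_d` is monic in `t`.
[cite: NetzerPlaumannThom2013, §1 («a monic univariate polynomial in `t`»)] -/
theorem monic_homogenization (p : MvPolynomial ι R) (d : ℕ) (hp : MvPolynomial.constantCoeff p = 1) :
    (homogenization p d).Monic := by
  nontriviality R
  have hcoeff : (homogenization p d).coeff d = 1 := by
    rw [coeff_homogenization_self, hp, map_one]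
  have hdeg : (homogenization p d).natDegree = d :=
    le_antisymm (natDegree_homogenization_le p d)
      (Polynomial.le_natDegree_of_ne_zero (by rw [hcoeff]; exact one_ne_zero))
  rw [Polynomial.Monic, Polynomial.leadingCoeff, hdeg, hcoeff]

/-- `P(x,t)` is monic of degree exactly `d` when `p(0) = 1` (over a nontrivial ring).
[cite: NetzerPlaumannThom2013, §1] -/
theorem natDegree_homogenization [Nontrivial R] (p : MvPolynomial ι R) (d : ℕ)
    (hp : MvPolynomial.constantCoeff p = 1) : (homogenization p d).natDegree = d := by
  refine le_antisymm (natDegree_homogenization_le p d) (Polynomial.le_natDegree_of_ne_zero ?_)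
  rw [coeff_homogenization_self, hp, map_one]
  exact one_ne_zero

/-- Homogeneous components commute with a change of coefficients. [cite: NetzerPlaumannThom2013, §1 (homogeneous parts `p_i`)] -/
theorem homogeneousComponent_map {S : Type*} [CommRing S] (f : R →+* S) (n : ℕ)
    (φ : MvPolynomial ι R) :
    MvPolynomial.map f (MvPolynomial.homogeneousComponent n φ) =
      MvPolynomial.homogeneousComponent n (MvPolynomial.map f φ) := by
  ext m
  rw [MvPolynomial.coeff_map, MvPolynomial.coeff_homogeneousComponent,
    MvPolynomial.coeff_homogeneousComponent, MvPolynomial.coeff_map]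
  split_ifs <;> simp

/-- The homogenisation commutes with ring homomorphisms of the coefficients. [cite: NetzerPlaumannThom2013, §1 (homogenisation)] -/
theorem map_homogenization {S : Type*} [CommRing S] (f : R →+* S) (p : MvPolynomial ι R) (d : ℕ) :
    (homogenization p d).map (MvPolynomial.map f) = homogenization (MvPolynomial.map f p) d := by
  rw [homogenization, homogenization, Polynomial.map_sum]
  refine Finset.sum_congr rfl fun i _ => ?_
  rw [Polynomial.map_mul, Polynomial.map_pow, Polynomial.map_C, Polynomial.map_X,
    homogeneousComponent_map]

/-- The **parametrised Hermite matrix** `𝓗(p)` of a polynomial `p` in the variables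
`x = (x_i)_{i ∈ ι}` (intended: `p(0) = 1`, `deg p ≤ d`): the Hermite matrix
`(N_{i+j}(P))_{0 ≤ i,j < d}` of the homogenisation `P(x,t) = t^d p(x/t)` regarded as a monic
polynomial in `t`, a symmetric `d × d` matrix with entries in `R[x]`; its `(i,j)` entry is
homogeneous of degree `i + j` (indices from `0`).  The Newton sums are taken through Newton's
recursion `newtonOfCoeff` on the homogeneous parts `p_1, …, p_d`, so that the entries are honest
polynomials; at every real point this is the tree's root-defined Hermite matrix of `P(a,t)`
(`map_eval_paramHermite`). [cite: NetzerPlaumannThom2013, §1 (before Cor. 1.2)] -/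
def paramHermite (p : MvPolynomial ι R) (d : ℕ) : Matrix (Fin d) (Fin d) (MvPolynomial ι R) :=
  hermiteOfCoeff d fun k => MvPolynomial.homogeneousComponent k p

/-- Entries of `𝓗(p)`. [cite: NetzerPlaumannThom2013, §1] -/
theorem paramHermite_apply (p : MvPolynomial ι R) (d : ℕ) (i j : Fin d) :
    paramHermite p d i j =
      newtonOfCoeff d (fun k => MvPolynomial.homogeneousComponent k p) ((i : ℕ) + j) := rfl

/-- `𝓗(p)` is a Hankel, hence symmetric, matrix. [cite: NetzerPlaumannThom2013, §1] -/
theorem paramHermite_isSymm (p : MvPolynomial ι R) (d : ℕ) : (paramHermite p d).IsSymm := by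
  ext i j
  simp [paramHermite_apply, add_comm]

/-- `𝓗(p)` commutes with ring homomorphisms of the coefficients (in particular with evaluation
at a point). [cite: NetzerPlaumannThom2013, §1 (definition of `𝓗(p)`)] -/
theorem map_paramHermite {S : Type*} [CommRing S] (f : MvPolynomial ι R →+* S)
    (p : MvPolynomial ι R) (d : ℕ) :
    (paramHermite p d).map f =
      hermiteOfCoeff d (fun k => f (MvPolynomial.homogeneousComponent k p)) :=
  map_hermiteOfCoeff f d _

end ParamHermite

/-! ## Specialisation at a real point: `𝓗(p)(a)` is the Hermite matrix of `t^d p(a/t)` -/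

section RealPoint

open Literature.Algebra.Polynomial
open Literature.AlgebraicGeometry.HyperbolicPolynomials (linePoly eval_linePoly)

variable {ι : Type*}

/-- The specialised homogenisation `P(a,t) ∈ ℝ[t]` at a point `a`. [cite: NetzerPlaumannThom2013, §1] -/
def homogenizationAt (p : MvPolynomial ι ℝ) (d : ℕ) (a : ι → ℝ) : ℝ[X] :=
  (homogenization p d).map (MvPolynomial.eval a)

/-- Coefficients of `P(a,t)`: the coefficient of `t^{d-k}` is `p_k(a)`. [cite: NetzerPlaumannThom2013, §1] -/
theorem coeff_homogenizationAt (p : MvPolynomial ι ℝ) (d : ℕ) (a : ι → ℝ) (k : ℕ) (hk : k ≤ d) :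
    (homogenizationAt p d a).coeff (d - k) =
      MvPolynomial.eval a (MvPolynomial.homogeneousComponent k p) := by
  rw [homogenizationAt, coeff_map, coeff_homogenization p d k hk]

/-- `P(a,t)` is monic of degree `d` when `p(0) = 1`. [cite: NetzerPlaumannThom2013, §1] -/
theorem monic_homogenizationAt (p : MvPolynomial ι ℝ) (d : ℕ) (a : ι → ℝ)
    (hp : MvPolynomial.constantCoeff p = 1) : (homogenizationAt p d a).Monic :=
  (monic_homogenization p d hp).map _

/-- `deg_t P(a,t) = d` when `p(0) = 1`. [cite: NetzerPlaumannThom2013, §1] -/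
theorem natDegree_homogenizationAt (p : MvPolynomial ι ℝ) (d : ℕ) (a : ι → ℝ)
    (hp : MvPolynomial.constantCoeff p = 1) : (homogenizationAt p d a).natDegree = d := by
  rw [homogenizationAt, (monic_homogenization p d hp).natDegree_map, natDegree_homogenization p d hp]

/-- **`𝓗(p)(a) = H(P(a,·))`.** At every real point `a`, the parametrised Hermite matrix
specialises to the Hermite matrix (`Literature.Algebra.Polynomial.hermiteMatrix`, Newton sums over
the complex roots) of the monic polynomial `P(a,t) = t^d p(a/t)`; here `p(0) = 1` and `deg p ≤ d`.
[cite: NetzerPlaumannThom2013, §1 (definition of `𝓗(p)`)] -/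
theorem map_eval_paramHermite (p : MvPolynomial ι ℝ) {d : ℕ} (hp : MvPolynomial.constantCoeff p = 1)
    (hd : p.totalDegree ≤ d) (a : ι → ℝ) :
    (paramHermite p d).map (MvPolynomial.eval a) = hermiteMatrix (homogenizationAt p d a) d := by
  rw [map_paramHermite]
  ext i j
  rw [hermiteOfCoeff_apply, hermiteMatrix_apply]
  have hdeg := natDegree_homogenizationAt p d a hp
  have h := newtonOfCoeff_eq_newtonSum (monic_homogenizationAt p d a hp)
    (fun k => MvPolynomial.eval a (MvPolynomial.homogeneousComponent k p)) (fun k hk => ?_) ((i : ℕ) + j)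
  · rwa [hdeg] at h
  · rw [hdeg]
    split_ifs with hkd
    · rw [coeff_homogenizationAt p d a k hkd]
    · rw [MvPolynomial.homogeneousComponent_eq_zero _ _ (lt_of_le_of_lt hd (not_le.mp hkd)),
        map_zero]

/-- The coefficients of the restriction `t ↦ f(t a)` to a line through the origin are the values
of the homogeneous parts: `coeff_k f(t a) = f_k(a)` (the substitution in the proof of Cor. 1.2).
[cite: NetzerPlaumannThom2013, Cor. 1.2 (proof)] -/
theorem coeff_linePoly_zero {R : Type*} [CommRing R] (f : MvPolynomial ι R) (a : ι → R) (k : ℕ) :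
    (linePoly f 0 a).coeff k = MvPolynomial.eval a (MvPolynomial.homogeneousComponent k f) := by
  classical
  rw [linePoly, MvPolynomial.aeval_def, MvPolynomial.eval₂_eq, MvPolynomial.homogeneousComponent_apply,
    map_sum, finsetSum_coeff, Finset.sum_filter]
  refine Finset.sum_congr rfl fun m _ => ?_
  have hprod : (∏ i ∈ m.support, (Polynomial.C (a i) * Polynomial.X + Polynomial.C ((0 : ι → R) i)) ^ m i)
      = Polynomial.C (∏ i ∈ m.support, a i ^ m i) * Polynomial.X ^ m.degree := by
    simp only [Pi.zero_apply, map_zero, add_zero, mul_pow, Finset.prod_mul_distrib, ← map_pow,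
      ← map_prod, Finset.prod_pow_eq_pow_sum]
    rfl
  rw [Polynomial.algebraMap_eq, hprod, ← mul_assoc, ← map_mul, Polynomial.coeff_C_mul_X_pow,
    MvPolynomial.eval_monomial]
  split_ifs with h1 h2 h2
  · rfl
  · exact absurd h1.symm h2
  · exact absurd h2.symm h1
  · rfl

/-- `P(a,t) = t^d · p(a/t)` is the reflection of the line restriction `t ↦ p(t a)` (`deg p ≤ d`).
[cite: NetzerPlaumannThom2013, §1 (proof of Cor. 1.2)] -/
theorem homogenizationAt_eq_reflect (p : MvPolynomial ι ℝ) {d : ℕ} (hd : p.totalDegree ≤ d)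
    (a : ι → ℝ) : homogenizationAt p d a = (linePoly p 0 a).reflect d := by
  ext i
  rw [coeff_reflect, coeff_linePoly_zero]
  by_cases hi : i ≤ d
  · rw [revAt_le hi]
    have h := coeff_homogenizationAt p d a (d - i) (Nat.sub_le d i)
    rwa [Nat.sub_sub_self hi] at h
  · push Not at hi
    rw [homogenizationAt, coeff_map, coeff_homogenization_of_lt p d i hi, map_zero,
      MvPolynomial.homogeneousComponent_eq_zero _ _ (lt_of_le_of_lt hd ?_), map_zero]
    have hrev : revAt d i = i := by
      simp only [revAt, Function.Embedding.coeFn_mk, if_neg (not_le.mpr hi)]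
    rw [hrev]
    exact hi

/-- Reflection is an involution on coefficients. [folklore] -/
private theorem reflect_reflect {K : Type*} [Semiring K] (f : K[X]) (N : ℕ) :
    (f.reflect N).reflect N = f := by
  ext i
  rw [coeff_reflect, coeff_reflect, revAt_invol]

/-- The reflection `t^N f(1/t)` of a split polynomial is split (same proof as the tree's
`Literature.AlgebraicGeometry.DeterminantalHypersurfaces.splits_reflect` in
`HeltonVinnikovProofs`, repeated here to keep the imports light). [folklore] -/
private theorem splits_reflect' {K : Type*} [Field K] {f : K[X]} (hf : f.Splits) :
    ∀ N, f.natDegree ≤ N → (f.reflect N).Splits := by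
  induction hf using Submonoid.closure_induction with
  | mem g hg =>
      intro N hN
      rcases hg with ⟨a, rfl⟩ | ⟨a, rfl⟩
      · rw [reflect_C]
        exact Splits.C_mul_X_pow a N
      · have h1 : (X + C a : K[X]).natDegree = 1 := natDegree_X_add_C a
        rw [h1] at hN
        obtain ⟨M, rfl⟩ : ∃ M, N = M + 1 := ⟨N - 1, by omega⟩
        have hrefl : (X + C a : K[X]).reflect (M + 1) = X ^ M * (C a * X + C 1) := by
          rw [reflect_add, reflect_C, ← pow_one (X : K[X]), reflect_monomial, revAt_le hN, pow_one,
            Nat.add_sub_cancel, map_one]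
          ring
        rw [hrefl]
        exact (Splits.X_pow _).mul (Splits.of_natDegree_le_one natDegree_linear_le)
  | one => intro N _; rw [reflect_one]; exact Splits.X_pow N
  | mul f g hf hg ihf ihg =>
      intro N hN
      by_cases hf0 : f = 0
      · subst hf0; simp
      by_cases hg0 : g = 0
      · subst hg0; simp
      have hdeg : (f * g).natDegree = f.natDegree + g.natDegree := natDegree_mul hf0 hg0
      have hsplit : N = f.natDegree + (N - f.natDegree) := by omega
      rw [hsplit, reflect_mul f g le_rfl (by omega)]
      exact (ihf _ le_rfl).mul (ihg _ (by omega))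

/-- `t ↦ p(t a)` has only real zeros iff `t ↦ t^d p(a/t)` has (for `p(0) = 1`, `deg p ≤ d`): the
substitution `t ↦ 1/t` of the proof of Cor. 1.2. [cite: NetzerPlaumannThom2013, Cor. 1.2 (proof)] -/
theorem splits_linePoly_iff_splits_homogenizationAt (p : MvPolynomial ι ℝ) {d : ℕ}
    (hd : p.totalDegree ≤ d) (a : ι → ℝ) :
    (linePoly p 0 a).Splits ↔ (homogenizationAt p d a).Splits := by
  have hdegL : (linePoly p 0 a).natDegree ≤ d := by
    rw [Polynomial.natDegree_le_iff_coeff_eq_zero]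
    intro k hk
    rw [coeff_linePoly_zero, MvPolynomial.homogeneousComponent_eq_zero _ _
      (lt_of_le_of_lt hd (by exact_mod_cast hk)), map_zero]
  rw [homogenizationAt_eq_reflect p hd a]
  refine ⟨fun h => splits_reflect' h d hdegL, fun h => ?_⟩
  have h2 := splits_reflect' h d
    ((Polynomial.natDegree_le_iff_coeff_eq_zero).mpr fun k hk => by
      rw [coeff_reflect]
      have hk' : d < k := by exact_mod_cast hk
      have hrev : revAt d k = k := by
        simp only [revAt, Function.Embedding.coeFn_mk, if_neg (not_le.mpr hk')]
      rw [hrev]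
      exact Polynomial.coeff_eq_zero_of_natDegree_lt (lt_of_le_of_lt hdegL hk'))
  rwa [reflect_reflect] at h2

/-- **NPT 2013, Cor. 1.2.** A polynomial `p ∈ ℝ[x]` with `p(0) = 1` (and `deg p ≤ d`) is a real-zero
polynomial (`IsRZPoly`: every `t ↦ p(t a)` has only real zeros) if and only if the parametrised
Hermite matrix `𝓗(p)(a)` is positive semidefinite for all `a ∈ ℝⁿ` — by Hermite's theorem
(the tree's `splits_iff_posSemidef_hermiteMatrix`) applied to `t^d p(a/t)`.
[cite: NetzerPlaumannThom2013, Cor. 1.2] -/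
theorem cor_1_2 (p : MvPolynomial ι ℝ) {d : ℕ} (hp : MvPolynomial.constantCoeff p = 1)
    (hd : p.totalDegree ≤ d) :
    IsRZPoly p ↔ ∀ a : ι → ℝ, ((paramHermite p d).map (MvPolynomial.eval a)).PosSemidef := by
  refine forall_congr' fun a => ?_
  rw [splits_linePoly_iff_splits_homogenizationAt p hd a, map_eval_paramHermite p hp hd a]
  exact splits_iff_posSemidef_hermiteMatrix (natDegree_homogenizationAt p d a hp).le

end RealPoint

/-! ## Lemma 1.4 and Theorem 1.6: determinantal representations make `𝓗(p)` a sum of squares -/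

section TracePowers

variable {n : Type*} [Fintype n] [DecidableEq n]

/-- Traces of powers of a real symmetric matrix are the power sums of its eigenvalues
(«the trace of `𝓜(a)^s` is the `s`-power sum of the … eigenvalues of `𝓜(a)`»).
[cite: NetzerPlaumannThom2013, Lemma 1.4 (proof)] -/
theorem trace_pow_eq_sum_eigenvalues_pow (W : Matrix n n ℝ) (hW : W.IsHermitian) (s : ℕ) :
    (W ^ s).trace = ∑ i, hW.eigenvalues i ^ s := by
  set U : Matrix n n ℝ := (hW.eigenvectorUnitary : Matrix n n ℝ) with hU
  have hspec : W = U * diagonal hW.eigenvalues * star U := by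
    have h := hW.spectral_theorem
    rw [Unitary.conjStarAlgAut_apply] at h
    simpa [RCLike.ofReal_real_eq_id] using h
  have hunit : U * star U = 1 := Matrix.mem_unitaryGroup_iff.mp (hW.eigenvectorUnitary).2
  have hunit' : star U * U = 1 := Matrix.mem_unitaryGroup_iff'.mp (hW.eigenvectorUnitary).2
  have hWU : W * U = U * diagonal hW.eigenvalues := by
    calc W * U = U * diagonal hW.eigenvalues * star U * U := by rw [← hspec]
      _ = U * diagonal hW.eigenvalues := by rw [Matrix.mul_assoc, hunit', Matrix.mul_one]
  have hpow : ∀ s : ℕ, W ^ s * U = U * diagonal (fun i => hW.eigenvalues i ^ s) := by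
    intro s
    induction s with
    | zero => simp
    | succ s ih =>
        rw [pow_succ', Matrix.mul_assoc, ih, ← Matrix.mul_assoc, hWU, Matrix.mul_assoc,
          diagonal_mul_diagonal]
        simp [pow_succ']
  have hpow' : ∀ s : ℕ, W ^ s = U * diagonal (fun i => hW.eigenvalues i ^ s) * star U := by
    intro s
    rw [← hpow, Matrix.mul_assoc, hunit, Matrix.mul_one]
  rw [hpow', Matrix.trace_mul_cycle, hunit', Matrix.one_mul, trace_diagonal]

/-- `(−W)^s = (−1)^s W^s`. [folklore] -/
private theorem neg_pow_eq_smul (W : Matrix n n ℝ) (s : ℕ) : (-W) ^ s = ((-1 : ℝ) ^ s) • W ^ s := by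
  induction s with
  | zero => simp
  | succ s ih =>
      rw [pow_succ, pow_succ, pow_succ, ih, smul_mul_assoc, Matrix.mul_neg, mul_neg_one, neg_smul,
        smul_neg]

/-- Traces of powers of `𝓜(a) = −W` for a real symmetric `W`. [cite: NetzerPlaumannThom2013, Lemma 1.4 (proof)] -/
theorem trace_neg_pow_eq_sum (W : Matrix n n ℝ) (hW : W.IsHermitian) (s : ℕ) :
    ((-W) ^ s).trace = ∑ i, (-hW.eigenvalues i) ^ s := by
  rw [neg_pow_eq_smul, trace_smul, trace_pow_eq_sum_eigenvalues_pow W hW s, smul_eq_mul,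
    Finset.mul_sum]
  refine Finset.sum_congr rfl fun i _ => ?_
  rw [neg_pow (hW.eigenvalues i)]

end TracePowers

section Reflect

variable {R : Type*} [CommRing R]

/-- Reflecting a product of linear factors `c t + 1`: `reflect (N + |S|) ∏ (c_l t + 1) = t^N ∏ (t + c_l)`
(«the zeros of `p(ta)` correspond to the inverses of the zeros of `t^d p(t⁻¹a)`»).
[cite: NetzerPlaumannThom2013, Lemma 1.4 (proof)] -/
theorem reflect_prod_C_mul_X_add_one {α : Type*} [DecidableEq α] (S : Finset α) (c : α → R) (N : ℕ) :
    (∏ l ∈ S, (C (c l) * X + 1)).reflect (N + S.card) = X ^ N * ∏ l ∈ S, (X + C (c l)) := by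
  have hdeg1 : ∀ x : R, (C x * X + 1 : R[X]).natDegree ≤ 1 := by
    intro x
    have h := natDegree_linear_le (a := x) (b := (1 : R))
    rwa [map_one] at h
  have h1 : ∀ x : R, (C x * X + 1 : R[X]).reflect 1 = X + C x := by
    intro x
    rw [reflect_add, ← pow_one (X : R[X]), reflect_C_mul_X_pow, revAt_le le_rfl, Nat.sub_self,
      pow_zero, mul_one, reflect_one, pow_one, add_comm]
  induction S using Finset.induction_on with
  | empty => simp [reflect_one]
  | insert a S ha ih =>
      have hdegS : (∏ l ∈ S, (C (c l) * X + 1 : R[X])).natDegree ≤ N + S.card :=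
        (natDegree_prod_le _ _).trans
          ((Finset.sum_le_card_nsmul _ _ 1 fun l _ => hdeg1 _).trans (by simp))
      rw [Finset.prod_insert ha, Finset.prod_insert ha, Finset.card_insert_of_notMem ha,
        show N + (S.card + 1) = 1 + (N + S.card) by ring, reflect_mul _ _ (hdeg1 _) hdegS, ih, h1]
      ring

/-- Reflection commutes with powers: `(reflect d f)^r = reflect (d r) (f^r)` for `deg f ≤ d`.
[cite: NetzerPlaumannThom2013, Lemma 1.4 (proof)] -/
theorem reflect_pow_eq {f : R[X]} {d : ℕ} (hf : f.natDegree ≤ d) (r : ℕ) :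
    (f.reflect d) ^ r = (f ^ r).reflect (d * r) := by
  induction r with
  | zero => rw [pow_zero, pow_zero, Nat.mul_zero, reflect_one, pow_zero]
  | succ r ih =>
      rw [pow_succ, pow_succ, ih, Nat.mul_succ, reflect_mul _ _ (natDegree_pow_le.trans (by
        rw [mul_comm]; exact Nat.mul_le_mul_right r hf)) hf]

end Reflect

section Lemma14

open Literature.Algebra.Polynomial
open Literature.AlgebraicGeometry.HyperbolicPolynomials (linePoly eval_linePoly)

variable {ι : Type*} {n : Type*} [Fintype n] [DecidableEq n]

/-- `deg_t p(t a) ≤ d` when `deg p ≤ d`. [cite: NetzerPlaumannThom2013, Lemma 1.4 (proof)] -/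
theorem natDegree_linePoly_zero_le (p : MvPolynomial ι ℝ) {d : ℕ} (hd : p.totalDegree ≤ d) (a : ι → ℝ) :
    (linePoly p 0 a).natDegree ≤ d := by
  rw [Polynomial.natDegree_le_iff_coeff_eq_zero]
  intro k hk
  rw [coeff_linePoly_zero, MvPolynomial.homogeneousComponent_eq_zero _ _
    (lt_of_le_of_lt hd (by exact_mod_cast hk)), map_zero]

/-- **The key factorisation behind Lemma 1.4.** If `p^r = det(I − 𝓜)` with
`𝓜 = −∑ xᵢAᵢ` (`Aᵢ` real symmetric of any size), `p(0) = 1`, `deg p ≤ d`, then at every point `a`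
`P(a,t)^r = t^{dr−m} ∏_{μ ≠ 0} (t + μ)`, where `μ` runs over the non-zero eigenvalues of
`W = ∑ aᵢAᵢ = −𝓜(a)` (with multiplicity) and `m` is their number: the zeros of `t^d p(t⁻¹a)` are the
inverses of the zeros of `p(ta)`, i.e. (Prop. 1.3) the non-zero eigenvalues of `𝓜(a)`, each
`r`-fold. [cite: NetzerPlaumannThom2013, Lemma 1.4 (proof) with Prop. 1.3] -/
theorem homogenizationAt_pow_eq [Fintype ι] (A : ι → Matrix n n ℝ)
    (p : MvPolynomial ι ℝ) {d : ℕ} (hd : p.totalDegree ≤ d) {r : ℕ}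
    (hrep : p ^ r = monicPencilDet A) (a : ι → ℝ)
    (hW : (∑ i, a i • A i).IsHermitian) :
    let S := (univ : Finset n).filter (fun l => hW.eigenvalues l ≠ 0)
    S.card ≤ d * r ∧
    (homogenizationAt p d a) ^ r =
      X ^ (d * r - S.card) * ∏ l ∈ S, (X + C (hW.eigenvalues l)) := by
  intro S
  -- the line restriction of `p^r` is `det (I + tW) = ∏ (μ_l t + 1)`
  have hL : (linePoly p 0 a) ^ r = ∏ l, (C (hW.eigenvalues l) * X + 1) := by
    have h : linePoly (p ^ r) 0 a = (linePoly p 0 a) ^ r := by simp only [linePoly, map_pow]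
    rw [← h, hrep, linePoly_monicPencilDet_zero, lineDet_eq_prod _ hW]
  have hLS : (linePoly p 0 a) ^ r = ∏ l ∈ S, (C (hW.eigenvalues l) * X + 1) := by
    rw [hL, ← Finset.prod_filter_mul_prod_filter_not univ (fun l => hW.eigenvalues l ≠ 0)]
    rw [Finset.prod_congr rfl (s₂ := univ.filter fun l => ¬ hW.eigenvalues l ≠ 0)
      (g := fun _ => (1 : ℝ[X])) (fun l hl => by
        rw [Finset.mem_filter, not_not] at hl
        rw [hl.2, map_zero, zero_mul, zero_add]), Finset.prod_const_one, mul_one]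
  -- count: `m = |S| = deg (p(ta)^r) ≤ r d`
  have hm : S.card ≤ d * r := by
    have h1 : ((linePoly p 0 a) ^ r).natDegree ≤ d * r := natDegree_pow_le.trans (by
      rw [mul_comm]; exact Nat.mul_le_mul_right r (natDegree_linePoly_zero_le p hd a))
    have h2 : ((linePoly p 0 a) ^ r).natDegree = S.card := by
      rw [hLS, natDegree_prod _ _ fun l hl => ?_]
      · rw [Finset.sum_congr rfl fun l hl => ?_, Finset.sum_const, smul_eq_mul, mul_one]
        rw [Finset.mem_filter] at hl
        rw [← C_1, natDegree_linear hl.2]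
      · intro h
        have := congr_arg (Polynomial.eval 0) h
        simp at this
    omega
  refine ⟨hm, ?_⟩
  rw [homogenizationAt_eq_reflect p hd a, reflect_pow_eq (natDegree_linePoly_zero_le p hd a), hLS]
  have hsplit : d * r = (d * r - S.card) + S.card := by omega
  rw [hsplit, reflect_prod_C_mul_X_add_one, ← hsplit]

omit [Fintype n] [DecidableEq n] in
/-- A real linear combination of symmetric matrices is symmetric. [folklore] -/
private theorem isSymm_sum_smul [Fintype ι] (A : ι → Matrix n n ℝ) (hA : ∀ i, (A i).IsSymm)
    (a : ι → ℝ) : (∑ i, a i • A i).IsSymm := by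
  unfold Matrix.IsSymm
  rw [transpose_sum]
  exact Finset.sum_congr rfl fun i _ => by rw [transpose_smul, (hA i).eq]

omit [Fintype n] [DecidableEq n] in
/-- Power sums (`s ≥ 1`) of the complex roots of `t^N ∏_{l ∈ S} (t + μ_l)`: `Σ_{l∈S} (−μ_l)^s`. [folklore] -/
private theorem newtonSumC_X_pow_mul_prod (S : Finset n) (μ : n → ℝ) (N : ℕ) {s : ℕ} (hs : s ≠ 0) :
    newtonSumC ((X : ℝ[X]) ^ N * ∏ l ∈ S, (X + C (μ l))) s = ∑ l ∈ S, ((-(μ l) : ℝ) : ℂ) ^ s := by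
  have hne : ((X : ℝ[X]) ^ N * ∏ l ∈ S, (X + C (μ l))) ≠ 0 :=
    mul_ne_zero (pow_ne_zero _ X_ne_zero) (Finset.prod_ne_zero_iff.mpr fun l _ => X_add_C_ne_zero _)
  have hprod : ((∏ l ∈ S, (X + C (μ l)) : ℝ[X]).map (algebraMap ℝ ℂ)) =
      ∏ l ∈ S, (X + C ((μ l : ℝ) : ℂ)) := by
    rw [Polynomial.map_prod]
    simp
  rw [newtonSumC_def, aroots_mul hne, aroots_X_pow, Multiset.map_add, Multiset.sum_add,
    Multiset.map_nsmul, Multiset.sum_nsmul, Multiset.map_singleton, Multiset.sum_singleton,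
    zero_pow hs, smul_zero, zero_add, aroots_def, hprod,
    roots_prod _ _ (Finset.prod_ne_zero_iff.mpr fun l _ => X_add_C_ne_zero _)]
  simp only [roots_X_add_C]
  rw [Finset.sum_eq_multiset_sum]
  simp

/-- Newton sums are multiplied by `r` under `P ↦ P^r`. [folklore] -/
private theorem newtonSumC_pow (P : ℝ[X]) (r s : ℕ) : newtonSumC (P ^ r) s = r * newtonSumC P s := by
  rw [newtonSumC_def, newtonSumC_def, aroots_pow, Multiset.map_nsmul, Multiset.sum_nsmul, nsmul_eq_mul]

/-- **NPT 2013, Lemma 1.4.** Let `p ∈ ℝ[x]` with `p(0) = 1` and `deg p ≤ d`, and assume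
`p^r = det(I − 𝓜)` is a symmetric determinantal representation, `𝓜 = x₁M₁ + ⋯ + xₙMₙ` with real
symmetric `Mᵢ` of any size (tree normalisation: `p^r = monicPencilDet A`, `Mᵢ = −Aᵢ`).  Then for
all `a` and all `(i,j) ≠ (1,1)` (indices from `1` in print, from `0` here):
`r · 𝓗(p)(a)_{ij} = tr(𝓜(a)^{i+j−2})`.  (For `(i,j) = (1,1)`: `𝓗(p)_{11} = d` while
`tr 𝓜⁰ = k`, see `paramHermite_zero_zero`.)  The printed hypothesis «`p` real-zero» is automatic
here and not needed. [cite: NetzerPlaumannThom2013, Lemma 1.4] -/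
theorem lemma_1_4 [Fintype ι] (A : ι → Matrix n n ℝ) (hA : ∀ i, (A i).IsSymm)
    (p : MvPolynomial ι ℝ) (hp : MvPolynomial.constantCoeff p = 1) {d : ℕ} (hd : p.totalDegree ≤ d)
    {r : ℕ} (hrep : p ^ r = monicPencilDet A) (a : ι → ℝ) (i j : Fin d)
    (hij : (i : ℕ) + j ≠ 0) :
    (r : ℝ) * MvPolynomial.eval a (paramHermite p d i j) =
      ((-∑ l, a l • A l) ^ ((i : ℕ) + j)).trace := by
  have hW : (∑ l, a l • A l).IsHermitian :=
    Matrix.isHermitian_iff_isSymm.2 (isSymm_sum_smul A hA a)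
  obtain ⟨hm, hfac⟩ := homogenizationAt_pow_eq A p hd hrep a hW
  set S := (univ : Finset n).filter (fun l => hW.eigenvalues l ≠ 0) with hS
  -- the `(i,j)` entry of `𝓗(p)(a)` is the Newton sum `N_{i+j}(P(a,·))`
  have hentry : MvPolynomial.eval a (paramHermite p d i j) =
      newtonSum (homogenizationAt p d a) ((i : ℕ) + j) := by
    have h := congr_fun (congr_fun (map_eval_paramHermite p hp hd a) i) j
    rwa [Matrix.map_apply, hermiteMatrix_apply] at h
  -- complex computation: `r N_s(P_a) = N_s(P_a^r) = Σ_{l ∈ S} (−μ_l)^s = Σ_l (−μ_l)^s`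
  have hC : ((r : ℝ) : ℂ) * newtonSumC (homogenizationAt p d a) ((i : ℕ) + j) =
      ∑ l, ((-(hW.eigenvalues l) : ℝ) : ℂ) ^ ((i : ℕ) + j) := by
    rw [Complex.ofReal_natCast, ← newtonSumC_pow, hfac, newtonSumC_X_pow_mul_prod S _ _ hij,
      hS, Finset.sum_filter]
    refine Finset.sum_congr rfl fun l _ => ?_
    split_ifs with h
    · rfl
    · rw [not_not.mp h, neg_zero, Complex.ofReal_zero, zero_pow hij]
  -- back to `ℝ`
  rw [hentry, newtonSum_def, trace_neg_pow_eq_sum _ hW]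
  have hre := congr_arg Complex.re hC
  rw [Complex.re_ofReal_mul] at hre
  rw [hre, Complex.re_sum]
  refine Finset.sum_congr rfl fun l _ => ?_
  rw [← Complex.ofReal_pow, Complex.ofReal_re]

/-- The `(1,1)` entry of `𝓗(p)` is the constant `d` («`𝓗(p)_{1,1} = d`»). [cite: NetzerPlaumannThom2013, Lemma 1.4] -/
theorem paramHermite_zero_zero {R : Type*} [CommRing R] (p : MvPolynomial ι R) {d : ℕ} (hd : 0 < d) :
    paramHermite p d ⟨0, hd⟩ ⟨0, hd⟩ = (d : MvPolynomial ι R) := by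
  rw [paramHermite_apply, Nat.add_zero, newtonOfCoeff_zero]

end Lemma14

section Thm16

open Literature.Algebra.Polynomial
open Literature.Algebra.Polynomial.SosMatrix

variable {ι : Type*} [Fintype ι] {n : Type*} [Fintype n] [DecidableEq n]

/-- The symmetric linear matrix polynomial `𝓜 = −∑ xᵢAᵢ` of a monic pencil, as a matrix over `ℝ[x]`
(so that `det(I − 𝓜) = monicPencilDet A`). [cite: NetzerPlaumannThom2013, §1 (Prop. 1.3)] -/
def linPencil (A : ι → Matrix n n ℝ) : Matrix n n (MvPolynomial ι ℝ) :=
  -∑ i, (MvPolynomial.X i : MvPolynomial ι ℝ) • (A i).map MvPolynomial.C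

omit [Fintype n] [DecidableEq n] in
/-- Evaluation: `𝓜(a) = −∑ aᵢAᵢ`. [cite: NetzerPlaumannThom2013, §1] -/
theorem map_eval_linPencil (A : ι → Matrix n n ℝ) (a : ι → ℝ) :
    (linPencil A).map (MvPolynomial.eval a) = -∑ i, a i • A i := by
  ext l m
  simp [linPencil, Matrix.sum_apply]

/-- `det(I − 𝓜) = det(I + ∑ xᵢAᵢ)`. [cite: NetzerPlaumannThom2013, §1] -/
theorem det_one_sub_linPencil (A : ι → Matrix n n ℝ) :
    (1 - linPencil A).det = monicPencilDet A := by
  rw [linPencil, sub_neg_eq_add, monicPencilDet]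

/-- Powers of `𝓜` are symmetric when the `Aᵢ` are. [cite: NetzerPlaumannThom2013, Thm. 1.6 (proof)] -/
theorem isSymm_linPencil_pow (A : ι → Matrix n n ℝ) (hA : ∀ i, (A i).IsSymm) (s : ℕ) :
    ((linPencil A) ^ s).IsSymm := by
  refine Matrix.IsSymm.pow ?_ s
  unfold linPencil Matrix.IsSymm
  rw [transpose_neg, transpose_sum]
  congr 1
  exact Finset.sum_congr rfl fun i _ => by rw [transpose_smul, ← transpose_map, (hA i).eq]

/-- The matrix `𝒬` of the proof of Thm. 1.6: rows indexed by the entries `(ℓ,m)` of `𝓜`,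
`𝒬_{(ℓ,m), i} = (𝓜^i)_{ℓ m}` («`𝒬_{ℓm} = (q^{(0)}_{ℓm}, …, q^{(d−1)}_{ℓm})ᵀ`»).
[cite: NetzerPlaumannThom2013, Thm. 1.6 (proof)] -/
def sosWitness (A : ι → Matrix n n ℝ) (d : ℕ) : Matrix (n × n) (Fin d) (MvPolynomial ι ℝ) :=
  Matrix.of fun lm i => ((linPencil A) ^ (i : ℕ)) lm.1 lm.2

/-- Entries of the Gram matrix `𝒬ᵀ𝒬` at a point: `(𝒬ᵀ𝒬)(a)_{ij} = tr(𝓜(a)^i 𝓜(a)^j) = tr 𝓜(a)^{i+j}`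
(symmetry of `𝓜`). [cite: NetzerPlaumannThom2013, Thm. 1.6 (proof)] -/
theorem eval_transpose_sosWitness_mul_apply (A : ι → Matrix n n ℝ) (hA : ∀ i, (A i).IsSymm)
    (d : ℕ) (a : ι → ℝ) (i j : Fin d) :
    MvPolynomial.eval a (((sosWitness A d)ᵀ * sosWitness A d) i j) =
      ((-∑ l, a l • A l) ^ ((i : ℕ) + j)).trace := by
  have hM : ∀ s : ℕ, ((linPencil A) ^ s).map (MvPolynomial.eval a) = (-∑ l, a l • A l) ^ s := by
    intro s
    rw [Matrix.map_pow, map_eval_linPencil]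
  rw [Matrix.mul_apply, map_sum, Fintype.sum_prod_type, pow_add, ← hM, ← hM, Matrix.trace]
  refine Finset.sum_congr rfl fun l _ => ?_
  rw [Matrix.diag_apply, Matrix.mul_apply]
  refine Finset.sum_congr rfl fun m _ => ?_
  rw [transpose_apply]
  simp only [sosWitness, Matrix.of_apply, map_mul, Matrix.map_apply]
  rw [← (isSymm_linPencil_pow A hA j).apply l m]

/-- The identity of the proof of Thm. 1.6: `∑_{ℓ,m} 𝒬_{ℓm} 𝒬_{ℓm}ᵀ = (tr(𝓜^{i−1}𝓜^{j−1}))_{ij} = r 𝓗(p)`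
when `p^r = det(I − 𝓜)` has size `k = r d` (`p(0) = 1`, `deg p ≤ d`).
[cite: NetzerPlaumannThom2013, Thm. 1.6 (proof)] -/
theorem transpose_sosWitness_mul (A : ι → Matrix n n ℝ) (hA : ∀ i, (A i).IsSymm)
    (p : MvPolynomial ι ℝ) (hp : MvPolynomial.constantCoeff p = 1) {d : ℕ} (hd : p.totalDegree ≤ d)
    {r : ℕ} (hsize : Fintype.card n = r * d) (hrep : p ^ r = monicPencilDet A) :
    (sosWitness A d)ᵀ * sosWitness A d = (MvPolynomial.C (r : ℝ) : MvPolynomial ι ℝ) • paramHermite p d := by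
  refine Matrix.ext fun i j => ?_
  apply MvPolynomial.funext
  intro a
  rw [eval_transpose_sosWitness_mul_apply A hA d a i j, Matrix.smul_apply, smul_eq_mul, map_mul,
    MvPolynomial.eval_C]
  by_cases hij : (i : ℕ) + j = 0
  · -- the `(1,1)` entry: `tr 𝓜⁰ = k = r d = r · N_0`
    rw [paramHermite_apply, hij, newtonOfCoeff_zero, pow_zero, trace_one, map_natCast, hsize,
      Nat.cast_mul]
  · exact (lemma_1_4 A hA p hp hd hrep a i j hij).symm

/-- The same identity for a representation of arbitrary size `k`:
`𝒬ᵀ𝒬 = r · (𝓗(p) + (k/r − d) E₁₁)`. [cite: NetzerPlaumannThom2013, Rem. 1.7 (1) (proof: «clear from the above proof»)] -/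
theorem transpose_sosWitness_mul_of_pos (A : ι → Matrix n n ℝ) (hA : ∀ i, (A i).IsSymm)
    (p : MvPolynomial ι ℝ) (hp : MvPolynomial.constantCoeff p = 1) {d : ℕ} (hd0 : 0 < d)
    (hd : p.totalDegree ≤ d) {r : ℕ} (hr : 0 < r) (hrep : p ^ r = monicPencilDet A) :
    (sosWitness A d)ᵀ * sosWitness A d = (MvPolynomial.C (r : ℝ) : MvPolynomial ι ℝ) •
      (paramHermite p d + Matrix.single (⟨0, hd0⟩ : Fin d) (⟨0, hd0⟩ : Fin d)
        (MvPolynomial.C ((Fintype.card n : ℝ) / r - d))) := by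
  refine Matrix.ext fun i j => ?_
  apply MvPolynomial.funext
  intro a
  rw [eval_transpose_sosWitness_mul_apply A hA d a i j, Matrix.smul_apply, smul_eq_mul, map_mul,
    MvPolynomial.eval_C, Matrix.add_apply, map_add]
  by_cases hij : (i : ℕ) + j = 0
  · have hi : i = ⟨0, hd0⟩ := Fin.ext (by simp only; omega)
    have hj : j = ⟨0, hd0⟩ := Fin.ext (by simp only; omega)
    rw [paramHermite_apply, hij, newtonOfCoeff_zero, pow_zero, trace_one, map_natCast, hi, hj,
      Matrix.single_apply_same, MvPolynomial.eval_C]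
    have hr' : (r : ℝ) ≠ 0 := Nat.cast_ne_zero.mpr hr.ne'
    field_simp
    ring
  · have hne : ¬ ((⟨0, hd0⟩ : Fin d) = i ∧ (⟨0, hd0⟩ : Fin d) = j) := by
      rintro ⟨hi, hj⟩
      apply hij
      rw [← hi, ← hj]
      simp
    rw [Matrix.single_apply_of_ne _ _ _ _ _ hne, map_zero, add_zero]
    exact (lemma_1_4 A hA p hp hd hrep a i j hij).symm

/-- **NPT 2013, Theorem 1.6.** Let `p ∈ ℝ[x]` (with `p(0) = 1`, `deg p ≤ d`).  If a power `p^r`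
(`r > 0`) admits a definite symmetric determinantal representation of size `r·d`,
`p^r = det(I − 𝓜)` with `𝓜 = ∑ xᵢMᵢ`, `Mᵢ` real symmetric (tree: `p^r = monicPencilDet A`),
then the parametrised Hermite matrix `𝓗(p)` is a sum of squares of polynomial matrices
(`IsSosMatrix`, Def. 1.5 = the tree's `Literature.Algebra.Polynomial.SosMatrix.IsSosMatrix`):
`𝓗(p) = 𝒬ᵀ𝒬` with `𝒬 = r^{-1/2} ((𝓜^{i})_{ℓm})_{(ℓ,m), i}`.  (The printed hypothesis «`p`
real-zero» follows from the representation and is not used.) [cite: NetzerPlaumannThom2013, Thm. 1.6] -/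
theorem thm_1_6 (A : ι → Matrix n n ℝ) (hA : ∀ i, (A i).IsSymm)
    (p : MvPolynomial ι ℝ) (hp : MvPolynomial.constantCoeff p = 1) {d : ℕ} (hd : p.totalDegree ≤ d)
    {r : ℕ} (hr : 0 < r) (hsize : Fintype.card n = r * d) (hrep : p ^ r = monicPencilDet A) :
    IsSosMatrix (paramHermite p d) := by
  have hQ := transpose_sosWitness_mul A hA p hp hd hsize hrep
  set c : ℝ := (Real.sqrt r)⁻¹ with hc
  have hcr : c * c * r = 1 := by
    rw [hc, ← mul_inv, Real.mul_self_sqrt (Nat.cast_nonneg r), inv_mul_cancel₀]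
    exact Nat.cast_ne_zero.mpr hr.ne'
  have h : ((MvPolynomial.C c : MvPolynomial ι ℝ) • sosWitness A d)ᵀ *
      ((MvPolynomial.C c : MvPolynomial ι ℝ) • sosWitness A d) = paramHermite p d := by
    rw [transpose_smul, Matrix.smul_mul, Matrix.mul_smul, hQ, smul_smul, smul_smul, ← map_mul,
      ← map_mul, hcr, map_one, one_smul]
  rw [← h]
  exact isSosMatrix_transpose_mul_self _

/-- **NPT 2013, Remark 1.7 (3).** Consequently the discriminant `det 𝓗(p)` is a sum of squares in
`ℝ[x]` (Cauchy–Binet; the tree's `IsSosMatrix.isSumSq_det`) — «a fact that has long been known, at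
least since Borchardt's work from 1846». [cite: NetzerPlaumannThom2013, Rem. 1.7 (3)] -/
theorem rem_1_7_3 (A : ι → Matrix n n ℝ) (hA : ∀ i, (A i).IsSymm)
    (p : MvPolynomial ι ℝ) (hp : MvPolynomial.constantCoeff p = 1) {d : ℕ} (hd : p.totalDegree ≤ d)
    {r : ℕ} (hr : 0 < r) (hsize : Fintype.card n = r * d) (hrep : p ^ r = monicPencilDet A) :
    IsSumSq (paramHermite p d).det :=
  (thm_1_6 A hA p hp hd hr hsize hrep).isSumSq_det

/-- **NPT 2013, Remark 1.7 (1).** If the representation `p^r = det(I − 𝓜)` has size `k > r d`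
(indeed any size `k ≥ r d`), then `𝓗(p)` becomes a sum of squares after increasing the `(1,1)` entry
from `d` to `k/r`. [cite: NetzerPlaumannThom2013, Rem. 1.7 (1)] -/
theorem rem_1_7_1 (A : ι → Matrix n n ℝ) (hA : ∀ i, (A i).IsSymm)
    (p : MvPolynomial ι ℝ) (hp : MvPolynomial.constantCoeff p = 1) {d : ℕ} (hd0 : 0 < d)
    (hd : p.totalDegree ≤ d) {r : ℕ} (hr : 0 < r) (hrep : p ^ r = monicPencilDet A) :
    IsSosMatrix (paramHermite p d +
      Matrix.single (⟨0, hd0⟩ : Fin d) (⟨0, hd0⟩ : Fin d)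
        (MvPolynomial.C ((Fintype.card n : ℝ) / r - d))) := by
  have hQ := transpose_sosWitness_mul_of_pos A hA p hp hd0 hd hr hrep
  set c : ℝ := (Real.sqrt r)⁻¹ with hc
  have hcr : c * c * r = 1 := by
    rw [hc, ← mul_inv, Real.mul_self_sqrt (Nat.cast_nonneg r), inv_mul_cancel₀]
    exact Nat.cast_ne_zero.mpr hr.ne'
  have h : ((MvPolynomial.C c : MvPolynomial ι ℝ) • sosWitness A d)ᵀ *
      ((MvPolynomial.C c : MvPolynomial ι ℝ) • sosWitness A d) = paramHermite p d +
      Matrix.single (⟨0, hd0⟩ : Fin d) (⟨0, hd0⟩ : Fin d)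
        (MvPolynomial.C ((Fintype.card n : ℝ) / r - d)) := by
    rw [transpose_smul, Matrix.smul_mul, Matrix.mul_smul, hQ, smul_smul, smul_smul, ← map_mul,
      ← map_mul, hcr, map_one, one_smul]
  rw [← h]
  exact isSosMatrix_transpose_mul_self _

/-- **NPT 2013, Remark 1.7 (2).** By Netzer–Thom's size reduction (the tree's
`NetzerThom2012.thm_2_4`: a monic symmetric representation can be compressed to size `n·deg`), if
ANY power `p^r` admits a definite symmetric determinantal representation of ANY size, then `𝓗(p)`
is a sum of squares after increasing the `(1,1)` entry from `d` to `d n` (`n` = number of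
variables) — independently of `r`. [cite: NetzerPlaumannThom2013, Rem. 1.7 (2)] -/
theorem rem_1_7_2 (A : ι → Matrix n n ℝ) (hA : ∀ i, (A i).IsSymm)
    (p : MvPolynomial ι ℝ) (hp : MvPolynomial.constantCoeff p = 1) {d : ℕ} (hd0 : 0 < d)
    (hd : p.totalDegree ≤ d) {r : ℕ} (hr : 0 < r) (hrep : p ^ r = monicPencilDet A) :
    IsSosMatrix (paramHermite p d +
      Matrix.single (⟨0, hd0⟩ : Fin d) (⟨0, hd0⟩ : Fin d)
        (MvPolynomial.C ((Fintype.card ι : ℝ) * d - d))) := by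
  have hdeg : (p ^ r).totalDegree ≤ r * d :=
    (MvPolynomial.totalDegree_pow p r).trans (Nat.mul_le_mul_left r hd)
  obtain ⟨M', hM', hrep'⟩ := NetzerThom2012.thm_2_4 (p ^ r) hdeg A hA hrep.symm
  have h := rem_1_7_1 M' hM' p hp hd0 hd hr hrep'.symm
  have hval : ((Fintype.card (Fin (Fintype.card ι * (r * d))) : ℝ) / r - d) =
      (Fintype.card ι : ℝ) * d - d := by
    rw [Fintype.card_fin, Nat.cast_mul, Nat.cast_mul]
    field_simp
  rwa [hval] at h

end Thm16

/-! ## Example 1.8: quadratic polynomials -/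

section Example18

open Literature.Algebra.Polynomial.SosMatrix

variable {m : ℕ}

/-- The general quadratic `p = xᵀAx + bᵀx + 1` of Example 1.8. [cite: NetzerPlaumannThom2013, Example 1.8] -/
def quadPoly (A : Matrix (Fin m) (Fin m) ℝ) (b : Fin m → ℝ) : MvPolynomial (Fin m) ℝ :=
  (∑ i, ∑ j, MvPolynomial.C (A i j) * MvPolynomial.X i * MvPolynomial.X j) +
    (∑ i, MvPolynomial.C (b i) * MvPolynomial.X i) + 1

/-- The linear form `bᵀx`. [cite: NetzerPlaumannThom2013, Example 1.8] -/
def linForm (b : Fin m → ℝ) : MvPolynomial (Fin m) ℝ := ∑ i, MvPolynomial.C (b i) * MvPolynomial.X i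

/-- The quadratic form `xᵀAx`. [cite: NetzerPlaumannThom2013, Example 1.8] -/
def quadForm' (A : Matrix (Fin m) (Fin m) ℝ) : MvPolynomial (Fin m) ℝ :=
  ∑ i, ∑ j, MvPolynomial.C (A i j) * MvPolynomial.X i * MvPolynomial.X j

/-- `bᵀx` is a linear form. [cite: NetzerPlaumannThom2013, Example 1.8] -/
theorem isHomogeneous_linForm (b : Fin m → ℝ) : (linForm b).IsHomogeneous 1 := by
  unfold linForm
  refine MvPolynomial.IsHomogeneous.sum _ _ _ fun i _ => ?_
  exact (MvPolynomial.isHomogeneous_C _ _).mul (MvPolynomial.isHomogeneous_X _ _)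

/-- `xᵀAx` is a quadratic form. [cite: NetzerPlaumannThom2013, Example 1.8] -/
theorem isHomogeneous_quadForm' (A : Matrix (Fin m) (Fin m) ℝ) : (quadForm' A).IsHomogeneous 2 := by
  unfold quadForm'
  refine MvPolynomial.IsHomogeneous.sum _ _ _ fun i _ => ?_
  refine MvPolynomial.IsHomogeneous.sum _ _ _ fun j _ => ?_
  exact ((MvPolynomial.isHomogeneous_C _ _).mul (MvPolynomial.isHomogeneous_X _ _)).mul
    (MvPolynomial.isHomogeneous_X _ _)

/-- The homogeneous parts of `p = xᵀAx + bᵀx + 1`: `p_0 = 1`, `p_1 = bᵀx`, `p_2 = xᵀAx`, `p_k = 0`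
(`k ≥ 3`). [cite: NetzerPlaumannThom2013, Example 1.8] -/
theorem homogeneousComponent_quadPoly (A : Matrix (Fin m) (Fin m) ℝ) (b : Fin m → ℝ) (k : ℕ) :
    MvPolynomial.homogeneousComponent k (quadPoly A b) =
      if k = 0 then 1 else if k = 1 then linForm b else if k = 2 then quadForm' A else 0 := by
  have h2 := MvPolynomial.homogeneousComponent_of_mem (m := k)
    ((MvPolynomial.mem_homogeneousSubmodule 2 _).mpr (isHomogeneous_quadForm' A))
  have h1 := MvPolynomial.homogeneousComponent_of_mem (m := k)
    ((MvPolynomial.mem_homogeneousSubmodule 1 _).mpr (isHomogeneous_linForm b))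
  have h0 := MvPolynomial.homogeneousComponent_of_mem (m := k)
    ((MvPolynomial.mem_homogeneousSubmodule 0 _).mpr (MvPolynomial.isHomogeneous_one (Fin m) ℝ))
  have hp : quadPoly A b = quadForm' A + linForm b + 1 := rfl
  rw [hp, map_add, map_add, h2, h1, h0]
  by_cases hk0 : k = 0
  · subst hk0; simp
  by_cases hk1 : k = 1
  · subst hk1; simp
  by_cases hk2 : k = 2
  · subst hk2; simp
  simp [hk0, hk1, hk2]

/-- `p(0) = 1` for the quadratic of Example 1.8. [cite: NetzerPlaumannThom2013, Example 1.8] -/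
theorem constantCoeff_quadPoly (A : Matrix (Fin m) (Fin m) ℝ) (b : Fin m → ℝ) :
    MvPolynomial.constantCoeff (quadPoly A b) = 1 := by
  have h := homogeneousComponent_quadPoly A b 0
  rw [MvPolynomial.homogeneousComponent_zero, if_pos rfl] at h
  have h' := congr_arg MvPolynomial.constantCoeff h
  rwa [MvPolynomial.constantCoeff_C, map_one] at h'

/-- **NPT 2013, Example 1.8 (the Hermite matrix of a quadratic).** For `p = xᵀAx + bᵀx + 1`:
`𝓗(p) = [[2, −bᵀx], [−bᵀx, (bᵀx)² − 2xᵀAx]]` (the `(2,2)` entry is `xᵀ(bbᵀ − 2A)x`).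
[cite: NetzerPlaumannThom2013, Example 1.8] -/
theorem paramHermite_quadPoly (A : Matrix (Fin m) (Fin m) ℝ) (b : Fin m → ℝ) :
    paramHermite (quadPoly A b) 2 =
      !![2, -linForm b; -linForm b, linForm b ^ 2 - 2 * quadForm' A] := by
  have hc : ∀ k, MvPolynomial.homogeneousComponent k (quadPoly A b) =
      if k = 0 then 1 else if k = 1 then linForm b else if k = 2 then quadForm' A else 0 :=
    homogeneousComponent_quadPoly A b
  have hN1 : newtonOfCoeff 2 (fun k => MvPolynomial.homogeneousComponent k (quadPoly A b)) 1 =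
      -linForm b := by
    rw [newtonOfCoeff_succ]
    simp [hc]
  have hN2 : newtonOfCoeff 2 (fun k => MvPolynomial.homogeneousComponent k (quadPoly A b)) 2 =
      linForm b ^ 2 - 2 * quadForm' A := by
    rw [newtonOfCoeff_succ, Fin.sum_univ_one]
    simp only [Fin.val_zero, Nat.sub_zero, zero_add]
    rw [hN1]
    simp only [hc]
    norm_num
    ring
  refine Matrix.ext fun i j => ?_
  fin_cases i <;> fin_cases j
  · simp [paramHermite_apply]
  · simpa [paramHermite_apply, hermiteOfCoeff_apply] using hN1
  · simpa [paramHermite_apply, hermiteOfCoeff_apply] using hN1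
  · simpa [paramHermite_apply, hermiteOfCoeff_apply] using hN2

/-- `xᵀ(u uᵀ)x = (uᵀx)²`. [cite: NetzerPlaumannThom2013, Example 1.8] -/
theorem quadForm'_vecMulVec (u : Fin m → ℝ) : quadForm' (vecMulVec u u) = linForm u ^ 2 := by
  unfold quadForm' linForm
  rw [sq, Finset.sum_mul_sum]
  refine Finset.sum_congr rfl fun i _ => Finset.sum_congr rfl fun j _ => ?_
  rw [vecMulVec_apply, map_mul]
  ring

/-- `M ↦ xᵀMx` is additive. [cite: NetzerPlaumannThom2013, Example 1.8] -/
theorem quadForm'_add (M N : Matrix (Fin m) (Fin m) ℝ) :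
    quadForm' (M + N) = quadForm' M + quadForm' N := by
  unfold quadForm'
  rw [← Finset.sum_add_distrib]
  refine Finset.sum_congr rfl fun i _ => ?_
  rw [← Finset.sum_add_distrib]
  refine Finset.sum_congr rfl fun j _ => ?_
  rw [Matrix.add_apply, map_add]
  ring

/-- `M ↦ xᵀMx` is homogeneous. [cite: NetzerPlaumannThom2013, Example 1.8] -/
theorem quadForm'_smul (c : ℝ) (M : Matrix (Fin m) (Fin m) ℝ) :
    quadForm' (c • M) = MvPolynomial.C c * quadForm' M := by
  unfold quadForm'
  rw [Finset.mul_sum]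
  refine Finset.sum_congr rfl fun i _ => ?_
  rw [Finset.mul_sum]
  refine Finset.sum_congr rfl fun j _ => ?_
  rw [Matrix.smul_apply, smul_eq_mul, map_mul]
  ring

/-- `M ↦ xᵀMx` commutes with finite sums. [cite: NetzerPlaumannThom2013, Example 1.8] -/
theorem quadForm'_sum {κ : Type*} (s : Finset κ) (M : κ → Matrix (Fin m) (Fin m) ℝ) :
    quadForm' (∑ k ∈ s, M k) = ∑ k ∈ s, quadForm' (M k) := by
  classical
  induction s using Finset.induction_on with
  | empty => simp [quadForm']
  | insert a s ha ih => rw [Finset.sum_insert ha, Finset.sum_insert ha, quadForm'_add, ih]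

/-- The sum-of-squares identity behind Example 1.8: if `bbᵀ − 4A = ∑ vᵢvᵢᵀ` then
`∑ (vᵢᵀx)² = (bᵀx)² − 4 xᵀAx`. [cite: NetzerPlaumannThom2013, Example 1.8] -/
theorem sum_linForm_sq {κ : Type*} [Fintype κ] (A : Matrix (Fin m) (Fin m) ℝ) (b : Fin m → ℝ)
    (v : κ → Fin m → ℝ) (hv : vecMulVec b b - (4 : ℝ) • A = ∑ i, vecMulVec (v i) (v i)) :
    ∑ i, linForm (v i) ^ 2 = linForm b ^ 2 - 4 * quadForm' A := by
  have h := congr_arg quadForm' hv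
  rw [quadForm'_sum, sub_eq_add_neg, quadForm'_add, quadForm'_vecMulVec, ← neg_smul,
    quadForm'_smul] at h
  rw [← Finset.sum_congr rfl fun i _ => quadForm'_vecMulVec (v i), ← h, map_neg, map_ofNat]
  ring

/-- The matrix `𝒬` of Example 1.8: rows `(1, −½bᵀx)` and `(0, ½vᵢᵀx)` (`i = 1, …`).
[cite: NetzerPlaumannThom2013, Example 1.8] -/
def exampleQ {κ : ℕ} (b : Fin m → ℝ) (v : Fin κ → Fin m → ℝ) :
    Matrix (Fin (κ + 1)) (Fin 2) (MvPolynomial (Fin m) ℝ) :=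
  Matrix.of (Fin.cons ![1, -(MvPolynomial.C (1 / 2 : ℝ) * linForm b)]
    fun i => ![0, MvPolynomial.C (1 / 2 : ℝ) * linForm (v i)])

/-- **NPT 2013, Example 1.8 (the explicit sum of squares).** If `bbᵀ − 4A = ∑_{i} vᵢvᵢᵀ`
(which is possible iff `bbᵀ − 4A ⪰ 0`, i.e. iff `p` is a real-zero polynomial), then
`𝓗(p) = 2 · 𝒬ᵀ𝒬` with `𝒬` the matrix with rows `(1, −½bᵀx)`, `(0, ½vᵢᵀx)`.
[cite: NetzerPlaumannThom2013, Example 1.8] -/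
theorem example_1_8 {κ : ℕ} (A : Matrix (Fin m) (Fin m) ℝ) (b : Fin m → ℝ) (v : Fin κ → Fin m → ℝ)
    (hv : vecMulVec b b - (4 : ℝ) • A = ∑ i, vecMulVec (v i) (v i)) :
    paramHermite (quadPoly A b) 2 = (2 : MvPolynomial (Fin m) ℝ) • ((exampleQ b v)ᵀ * exampleQ b v) := by
  have hsq := sum_linForm_sq A b v hv
  have hu : (MvPolynomial.C (1 / 2 : ℝ) : MvPolynomial (Fin m) ℝ) * 2 = 1 := by
    rw [show (2 : MvPolynomial (Fin m) ℝ) = MvPolynomial.C 2 from (map_ofNat _ 2).symm, ← map_mul]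
    norm_num
  have hu' : (MvPolynomial.C (2⁻¹ : ℝ) : MvPolynomial (Fin m) ℝ) * 2 = 1 := by
    rw [← one_div]; exact hu
  rw [paramHermite_quadPoly]
  refine Matrix.ext fun i j => ?_
  rw [Matrix.smul_apply, Matrix.mul_apply, Fin.sum_univ_succ]
  simp only [exampleQ, transpose_apply, Matrix.of_apply, Fin.cons_zero, Fin.cons_succ]
  fin_cases i <;> fin_cases j
  · simp
  · simp
    linear_combination (-linForm b) * hu'
  · simp
    linear_combination (-linForm b) * hu'
  · simp only [Fin.mk_one, Fin.isValue, Matrix.cons_val_one, Matrix.cons_val',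
      Matrix.empty_val', Matrix.cons_val_fin_one, smul_eq_mul]
    have hS : ∑ x : Fin κ, MvPolynomial.C (1 / 2 : ℝ) * linForm (v x) *
        (MvPolynomial.C (1 / 2 : ℝ) * linForm (v x)) =
        MvPolynomial.C (1 / 2 : ℝ) * MvPolynomial.C (1 / 2 : ℝ) * ∑ x : Fin κ, linForm (v x) ^ 2 := by
      rw [Finset.mul_sum]
      refine Finset.sum_congr rfl fun x _ => ?_
      ring
    rw [hS]
    linear_combination (-(linForm b ^ 2 - 2 * quadForm' A) * (2 * MvPolynomial.C (1 / 2 : ℝ) + 1)) * hu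
      + (-2 * MvPolynomial.C (1 / 2 : ℝ) ^ 2) * hsq

/-- Hermitian-ness of the real symmetric `2 × 2` matrix `[[2, x], [x, y]]`. [folklore] -/
private theorem isHermitian_two_two (x y : ℝ) : (!![2, x; x, y]).IsHermitian := by
  refine Matrix.IsHermitian.ext fun i j => ?_
  fin_cases i <;> fin_cases j <;> simp

/-- The `2 × 2` criterion used in Example 1.8 («as is easily checked»): `[[2, x], [x, y]] ⪰ 0 ⟺ 2y − x² ≥ 0`.
[cite: NetzerPlaumannThom2013, Example 1.8] -/
theorem posSemidef_two_two_iff (x y : ℝ) : (!![2, x; x, y]).PosSemidef ↔ 0 ≤ 2 * y - x ^ 2 := by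
  constructor
  · intro h
    have h1 := h.dotProduct_mulVec_nonneg ![-x / 2, 1]
    simp [Matrix.mulVec, dotProduct, Fin.sum_univ_two] at h1
    nlinarith [h1]
  · intro h
    refine PosSemidef.of_dotProduct_mulVec_nonneg (isHermitian_two_two x y) fun u => ?_
    simp [Matrix.mulVec, dotProduct, Fin.sum_univ_two]
    nlinarith [sq_nonneg (u 0 + x * u 1 / 2), sq_nonneg (u 1), mul_nonneg h (sq_nonneg (u 1))]

/-- Evaluating the linear form: `(bᵀx)(a) = b·a`. [cite: NetzerPlaumannThom2013, Example 1.8] -/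
theorem eval_linForm (b a : Fin m → ℝ) : MvPolynomial.eval a (linForm b) = b ⬝ᵥ a := by
  simp [linForm, dotProduct]

/-- Evaluating the quadratic form: `(xᵀMx)(a) = aᵀMa`. [cite: NetzerPlaumannThom2013, Example 1.8] -/
theorem eval_quadForm' (M : Matrix (Fin m) (Fin m) ℝ) (a : Fin m → ℝ) :
    MvPolynomial.eval a (quadForm' M) = a ⬝ᵥ (M *ᵥ a) := by
  simp only [quadForm', map_sum, map_mul, MvPolynomial.eval_C, MvPolynomial.eval_X, dotProduct,
    mulVec, Finset.mul_sum]
  refine Finset.sum_congr rfl fun i _ => Finset.sum_congr rfl fun j _ => ?_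
  ring

/-- `aᵀ(bbᵀ)a = (b·a)²`. [cite: NetzerPlaumannThom2013, Example 1.8] -/
theorem dotProduct_vecMulVec_mulVec (b a : Fin m → ℝ) :
    a ⬝ᵥ (vecMulVec b b *ᵥ a) = (b ⬝ᵥ a) ^ 2 := by
  simp only [dotProduct, mulVec, vecMulVec_apply]
  rw [sq, Finset.sum_mul_sum]
  refine Finset.sum_congr rfl fun i _ => ?_
  rw [Finset.mul_sum]
  refine Finset.sum_congr rfl fun j _ => ?_
  ring

/-- `deg (xᵀAx + bᵀx + 1) ≤ 2`. [cite: NetzerPlaumannThom2013, Example 1.8] -/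
theorem totalDegree_quadPoly_le (A : Matrix (Fin m) (Fin m) ℝ) (b : Fin m → ℝ) :
    (quadPoly A b).totalDegree ≤ 2 := by
  have hp : quadPoly A b = quadForm' A + linForm b + 1 := rfl
  rw [hp]
  refine (MvPolynomial.totalDegree_add _ _).trans (max_le ?_ (by simp))
  refine (MvPolynomial.totalDegree_add _ _).trans (max_le ?_ ?_)
  · exact (isHomogeneous_quadForm' A).totalDegree_le
  · exact (isHomogeneous_linForm b).totalDegree_le.trans one_le_two

/-- **NPT 2013, Example 1.8 («`p` is a real-zero polynomial if and only if `bbᵀ − 4A ⪰ 0`, as is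
easily checked»).** For real symmetric `A`: `xᵀAx + bᵀx + 1` is RZ iff `bbᵀ − 4A` is positive
semidefinite — via Cor. 1.2 and the `2 × 2` Hermite matrix of `paramHermite_quadPoly`.
[cite: NetzerPlaumannThom2013, Example 1.8] -/
theorem isRZPoly_quadPoly_iff (A : Matrix (Fin m) (Fin m) ℝ) (hA : A.IsSymm) (b : Fin m → ℝ) :
    IsRZPoly (quadPoly A b) ↔ (vecMulVec b b - (4 : ℝ) • A).PosSemidef := by
  rw [cor_1_2 (quadPoly A b) (constantCoeff_quadPoly A b) (totalDegree_quadPoly_le A b)]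
  have hmat : ∀ a : Fin m → ℝ, (paramHermite (quadPoly A b) 2).map (MvPolynomial.eval a) =
      !![2, -(b ⬝ᵥ a); -(b ⬝ᵥ a), (b ⬝ᵥ a) ^ 2 - 2 * (a ⬝ᵥ (A *ᵥ a))] := by
    intro a
    rw [paramHermite_quadPoly]
    refine Matrix.ext fun i j => ?_
    fin_cases i <;> fin_cases j <;> simp [eval_linForm, eval_quadForm']
  have hquad : ∀ a : Fin m → ℝ, a ⬝ᵥ ((vecMulVec b b - (4 : ℝ) • A) *ᵥ a) =
      (b ⬝ᵥ a) ^ 2 - 4 * (a ⬝ᵥ (A *ᵥ a)) := by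
    intro a
    rw [sub_mulVec, dotProduct_sub, dotProduct_vecMulVec_mulVec, smul_mulVec, dotProduct_smul,
      smul_eq_mul]
  have hsymm : (vecMulVec b b - (4 : ℝ) • A).IsHermitian := by
    refine Matrix.isHermitian_iff_isSymm.2 ?_
    unfold Matrix.IsSymm
    rw [transpose_sub, transpose_smul, transpose_vecMulVec, hA.eq]
  constructor
  · intro h
    refine PosSemidef.of_dotProduct_mulVec_nonneg hsymm fun a => ?_
    have ha := h a
    rw [hmat a, posSemidef_two_two_iff] at ha
    rw [star_trivial, hquad]
    nlinarith [ha]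
  · intro h a
    rw [hmat a, posSemidef_two_two_iff]
    have ha := h.dotProduct_mulVec_nonneg a
    rw [star_trivial, hquad] at ha
    nlinarith [ha]

end Example18


end Literature.AlgebraicGeometry.DeterminantalHypersurfaces.NetzerPlaumannThom2013
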